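import Literature.AlgebraicGeometry.Motives.HodgeThetaSubalgebraUnitaryTwoTwoCore
import Literature.AlgebraicGeometry.Motives.HodgeThetaSubalgebraUnitaryCoprimeCore
import Literature.AlgebraicGeometry.Motives.HodgeLieReductiveAnyWeight
import Mathlib.LinearAlgebra.Matrix.BilinearForm
import Mathlib.LinearAlgebra.BilinearForm.Properties
import Mathlib.Algebra.DirectSum.LinearMap
import Mathlib.LinearAlgebra.Trace
import HarnessLib

/-!
# The `Θ`-subalgebra theorem for unitary multiplicities `(2,2)`: an irreducible bracket-closed `𝔊 ⊆ 𝔰𝔩(W) ∋ Θ` with `Θ`-eigenspaces of dimensions `2, 2` and no invariant bilinear form is `𝔰𝔩(W)`; hence `𝔤_ℂ ⊇ 𝔰𝔲_K(V,ψ)_ℂ` for a polarized weight-one Hodge structure with `End_Hdg = K` imaginary quadratic acting with multiplicities `(2,2)` and `Lie Hg ⊗ ℂ ⊇ 𝔰𝔲_K(V,ψ)_ℂ` («`Hg ⊇ SU(V,ψ)`», simple abelian fourfolds of type IV(1,1); Moonen–Zarhin 1995, 1999 §2 (2.5))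

Family `hodge`, layer `Literature/AlgebraicGeometry/Motives`. Research context: cell `pub-hodge-ring2` (HONEST FRAMING:
research route conditional on HC_CM; not a corollary; Q11.4-sentence-2 already refuted in dim ≥ 3), Literature lane
gen 68, programme R45 (the Lie step of heir item (H1), sub-row «type IV(1,1), (2,2)»). UNCONDITIONAL; five
public theorems, no definition, no named fact (D-0026), no `sorry`; the `(2,2)` companion of the tree's
`HodgeThetaSubalgebraUnitary` (multiplicities `(m,1)`, THEOREM L′) and `HodgeThetaSubalgebraUnitaryTwoThree` (`(2,3)`,
THEOREM L″). At `(2,2)` two new phenomena enter, both visible in the statements: the conclusion is `𝔰𝔲`, not `𝔲`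
(`n' = n''`: the `K`-determinant, i.e. the Weil classes, must be respected — hypothesis `𝔤 ⊆ 𝔰𝔲_K`), and the two proper
irreducible `Θ`-configurations `𝔰𝔬₄ = 𝔰𝔩₂ ⊗ 1 + 1 ⊗ 𝔰𝔩₂`, `𝔰𝔭₄ ⊂ 𝔰𝔩₄` must be excluded — they carry an invariant
bilinear form on `W`, which `End_Hdg = K` forbids.

* §1 **`UnitaryThetaTwoTwo.mem_of_trace_eq_zero_of_irreducible`** (abstract form) transports the MATRIX CORE THEOREM
  `UnitaryThetaTwoTwo.mem_of_trace_eq_zero` (`HodgeThetaSubalgebraUnitaryTwoTwoCore`) to an abstract complex space `W`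
  in the vocabulary of the tree's `UnitaryThetaCore` (`HodgeThetaSubalgebraUnitaryCoprimeCore`): a basis `p₁, p₂` of
  `P = {Θ = 1}` and `q_i = C p_i` of `Q = {Θ = −1}`, `C ∈ 𝔊` a lowering operator injective on `P`
  (`UnitaryThetaCore.exists_lower_injOn`), identifies `End(W)` with `(2+2) × (2+2)` block matrices in which `C` is
  `fromBlocks 0 0 1 0`; a raising operator injective on `Q` (the same lemma for `−Θ`) is an invertible raising block;
  traces, commutators, stable subspaces and invariant bilinear forms correspond (`LinearMap.toMatrix`,
  `LinearMap.trace_eq_matrix_trace`, `Matrix.toBilin`).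
* §2 **`UnitaryThetaTwoTwo.mem_spanC_of_commute_of_skew`** (Hodge-theoretic form, setting of the `(m,1)` file): `H` an
  effective polarizable weight-one `ℚ`-Hodge structure, `ψ` a polarization, `End_Hdg(V) = ℚ + ℚφ`, `φ² = −d`,
  `μ² = −d`, `W = ker(φ_ℂ − μ)` with `dim W^{1,0} = dim W^{0,1} = 2`; `𝔤 ⊆ 𝔰𝔲_K(V,ψ)` a bracket-closed `ℚ`-subspace
  (commuting with `End_Hdg`, `ψ`-skew, `Tr(φX) = 0`) with `Θ ∈ 𝔤_ℂ`. Then every `Y` commuting with `φ_ℂ`, `ψ_ℂ`-skew,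
  with `tr(φ_ℂ Y) = 0` lies in `𝔤_ℂ`: **`𝔤_ℂ ⊇ 𝔰𝔲_K(V,ψ)_ℂ`**. The restrictions `𝔊 = 𝔤_ℂ|_W ⊆ 𝔰𝔩(W)` satisfy §1:
  irreducibility is the tree's `UnitaryTheta.eq_bot_or_eq_of_stable`; an invariant bilinear form `b` on `W` yields, via
  the projection `π = (2μ)⁻¹(μ + φ_ℂ)` and the duality `ψ_ℂ♭`, an operator `T` commuting with the `X_ℂ`, hence in
  `End_Hdg ⊗ ℂ = ℂ + ℂφ_ℂ` (`ThetaSubalgebra.mem_span_endAlg_of_forall_commute`), and `b = (α + βμ)ψ_ℂ|_{W×W} = 0`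
  (`W` is `ψ_ℂ`-isotropic); `Y = Z` on `W` forces `Y = Z` (`UnitaryTheta.eq_zero_of_forall_mem_eigenspace`).
* §3 **`UnitaryThetaTwoTwo.mem_hodgeLieC_of_commute_of_skew`** — **`Lie Hg(H) ⊗ ℂ ⊇ 𝔰𝔲_K(V,ψ)_ℂ`** («`Hg ⊇ SU(V,ψ)`»)
  for the Hodge Lie algebra itself (the tree's `hodgeLie` / `hodgeLieC`, `[HodgeTensorFacts]`), with NO trace hypothesis:
  §2 applied to the derived algebra `𝔡 = [𝔥, 𝔥]`, `𝔥 = Lie Hg(H)`, which is `K`-traceless (`Tr(φ[X,X']) = 0`) and has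
  `Θ` in its complex span — by `𝔥 = (𝔥 ∩ End_Hdg) ⊕ 𝔡` (Deligne I Prop. 3.6 in every weight, the tree's
  `AnyWeight.hodgeLie_center_sup_derived_eq`) `Θ = α + βφ_ℂ + δ`, and `α = β = 0` by traces on `V_ℂ` (skew operators
  are traceless) and on `W` (`tr Θ|_W = 2 − 2`). Consequently every Hodge class of every tensor construction of `H` is
  an `𝔰𝔲_K(V,ψ)`-invariant. The reverse inclusion `Lie Hg ⊆ 𝔰𝔲_K` (`φ ∉ Lie Hg`) is the Hodge-ness of the Weil classes
  `⋀⁴_K V` for `n' = n''` and is not proved here.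
* §4 **`UnitaryThetaTwoTwo.mem_spanC_of_commute_of_skew'`** — §2 WITHOUT the `K`-trace hypothesis, for ANY
  bracket-closed `𝔤` commuting with `End_Hdg`, `ψ`-skew, with `Θ ∈ 𝔤_ℂ` (the argument of §3 run for a general
  `Θ`-subalgebra: `𝔤 = (𝔤 ∩ End_Hdg) ⊕ [𝔤,𝔤]`, the tree's `ThetaSubalgebra.center_sup_derived_eq`); and
  **`UnitaryThetaTwoTwo.wordDerAt_eq_zero_of_commute_of_skew`** — THEOREM L for `𝔰𝔲` at `(2,2)`: a rational coefficient
  tensor killed slice-wise by the matrix of `Θ` is killed by the matrix of every `ψ_ℂ`-skew `Y` commuting with `φ_ℂ`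
  with `tr(φ_ℂ Y) = 0` (verbatim the `(2,3)` file's `annLie` argument with §4's theorem).
NOT here: the geometric assembly (`B•(Xⁿ) ⊆ ⟨D, W_K⟩` for simple abelian fourfolds of type IV(1,1) with `End⁰ = K` of
signature `(2,2)`: `AVSlots` + `SU(2,2)` invariant theory, van Geemen Thm. 6.12 / `VanGeemen1994.WeilTypeHodgeRingOfSU`).

THE PRINT. B. Moonen, Yu. Zarhin, Math. Ann. 315 (1999) §2 (2.5) (2) (held `paper:arxiv-math_9901113` p0005): «For
g = 4 we find cases where in addition to divisor classes we also need Weil classes to generate the Hodge ring. This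
happens if End⁰(X) contains an imaginary quadratic field k which acts on the tangent space with multiplicities (2,2)
… it can occur only for X of Type 4(1,1) or of Type 4(4,1)»; B. Moonen, Yu. Zarhin, Duke Math. J. 77 (1995) (simple
abelian fourfolds; for type IV(1,1) with `End⁰ = k` of signature `(2,2)` the Hodge group is `SU(V,ψ)` and the Hodge
ring is generated by divisors and Weil classes; cite-only, acq-04933); B. van Geemen, LNM 1594 (1994), Lemma 6.10 and
Thm. 6.11 (`MT(X) ⊆ SU(H,T)` for abelian varieties of Weil type, with equality in general); K. Ribet, Amer. J. Math. 105
(1983) Thm. 3 and B. Gordon's survey §6 (the `U(W')`-argument this file extends past the coprime case).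

## References
* [MoonenZarhin1999LowDim] B. Moonen, Yu. Zarhin, Math. Ann. 315 (1999), §2 (2.5) (2).
* [MoonenZarhin1995Duke] B. Moonen, Yu. Zarhin, Duke Math. J. 77 (1995) 553–581, main theorem (type IV(1,1), (2,2)).
* [vanGeemen1994HodgeAV] B. van Geemen, LNM 1594 (1994), Thm. 6.11 and Lemma 6.10.
* [Ribet1983] K. A. Ribet, Amer. J. Math. 105 (1983), Thm. 3.
* [Gordon1997] B. B. Gordon, *A survey of the Hodge conjecture for abelian varieties*, Thm. 6.3.3 and pp. 18–19.
* [Deligne1982HodgeCycles] P. Deligne, *Hodge cycles on abelian varieties*, LNM 900 (1982), I §3 Prop. 3.6.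
-/

noncomputable section

open Module Matrix
open scoped TensorProduct

namespace Literature.AlgebraicGeometry.Motives

namespace HodgeStructure

/-! ### §1 The abstract form: an irreducible bracket-closed `𝔊 ⊆ 𝔰𝔩(W) ∋ Θ` with multiplicities `(2,2)` and no invariant bilinear form is `𝔰𝔩(W)` -/

section Abstract

variable {W : Type*} [AddCommGroup W] [Module ℂ W]

/-- `−y = y` forces `y = 0` in a complex vector space. [folklore] -/
private theorem UnitaryThetaTwoTwo.eq_zero_of_neg_eq_self' {y : W} (h : -y = y) : y = 0 := by
  have h2 : (2 : ℂ) • y = 0 := by rw [two_smul]; nth_rewrite 1 [← h]; exact neg_add_cancel y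
  exact (smul_eq_zero.1 h2).resolve_left two_ne_zero

/-- **THE `Θ`-SUBALGEBRA THEOREM FOR UNITARY MULTIPLICITIES `(2,2)`** (abstract form). Let `𝔊 ⊆ End(W)` be a
`ℂ`-subspace closed under the commutator, consisting of TRACELESS operators, acting irreducibly on `W`, containing an
involution `Θ` whose eigenspaces `P = {Θ = 1}`, `Q = {Θ = −1}` both have dimension `2`, and such that no non-zero
bilinear form `b` on `W` is `𝔊`-invariant (`b(Xu, v) + b(u, Xv) = 0` for all `X ∈ 𝔊` forces `b = 0`). Then EVERY
traceless operator lies in `𝔊`: `𝔊 = 𝔰𝔩(W)`. (The two proper irreducible `Θ`-configurations with multiplicities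
`(2,2)`, `𝔰𝔬₄ = 𝔰𝔩₂ ⊗ 1 + 1 ⊗ 𝔰𝔩₂` and `𝔰𝔭₄`, preserve a symmetric, resp. alternating, form.) In the Hodge application
— `W = V_σ` for a polarized weight-one Hodge structure `V` of rank `8` with `End_Hdg(V) = k` imaginary quadratic of
signature `(2,2)`, `𝔊 = Lie Hg ⊗ ℂ |_W` — an invariant form would be a non-zero `Hg`-map `V_σ → V_σ^* ≅ V_σ̄`, excluded
by `End_Hdg = k`; the conclusion reads «`Hg = SU(V,ψ)`», the Hodge group of a simple abelian fourfold of type IV(1,1)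
with multiplicities `(2,2)`. Transport of `UnitaryThetaTwoTwo.mem_of_trace_eq_zero` through the basis
`(p₁, p₂, Cp₁, Cp₂)`. [cite: MoonenZarhin1999LowDim, §2 (2.5) (2)] [cite: MoonenZarhin1995Duke, main theorem (type IV(1,1), (2,2))]
[cite: vanGeemen1994HodgeAV, Thm. 6.11] [cite: Ribet1983, Thm. 3] [cite: Gordon1997, Thm. 6.3.3 and pp. 18–19] -/
theorem UnitaryThetaTwoTwo.mem_of_trace_eq_zero_of_irreducible [FiniteDimensional ℂ W]
    {𝔊 : Submodule ℂ (Module.End ℂ W)}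
    (hbr : ∀ Y ∈ 𝔊, ∀ Z ∈ 𝔊, Y * Z - Z * Y ∈ 𝔊)
    (hsl : ∀ X ∈ 𝔊, LinearMap.trace ℂ W X = 0)
    (hirr : ∀ U : Submodule ℂ W, (∀ A ∈ 𝔊, ∀ u ∈ U, A u ∈ U) → U = ⊥ ∨ U = ⊤)
    {Θ : Module.End ℂ W} (hΘ : Θ ∈ 𝔊) (hΘΘ : Θ * Θ = 1)
    {P Q : Submodule ℂ W} (hP : ∀ x, x ∈ P ↔ Θ x = x) (hQ : ∀ x, x ∈ Q ↔ Θ x = -x)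
    (hP2 : Module.finrank ℂ P = 2) (hQ2 : Module.finrank ℂ Q = 2)
    (hND : ∀ b : LinearMap.BilinForm ℂ W, (∀ X ∈ 𝔊, ∀ u v, b (X u) v + b u (X v) = 0) → b = 0)
    {Y : Module.End ℂ W} (hY : LinearMap.trace ℂ W Y = 0) : Y ∈ 𝔊 := by
  classical
  have hΘΘv : ∀ v, Θ (Θ v) = v := fun v => by rw [← Module.End.mul_apply, hΘΘ, Module.End.one_apply]
  -- a lowering operator injective on `P`, a raising operator injective on `Q`
  obtain ⟨C, hC, hΘC, hCΘ, hCinj⟩ :=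
    UnitaryThetaCore.exists_lower_injOn hbr hirr hΘ hΘΘ hP hQ hP2 (by rw [hQ2])
  have hnΘ : -Θ ∈ 𝔊 := Submodule.neg_mem _ hΘ
  have hnΘΘ : (-Θ) * (-Θ) = 1 := by rw [neg_mul_neg, hΘΘ]
  have hP' : ∀ x, x ∈ Q ↔ (-Θ) x = x := fun x => by rw [hQ, LinearMap.neg_apply, neg_eq_iff_eq_neg]
  have hQ' : ∀ x, x ∈ P ↔ (-Θ) x = -x := fun x => by rw [hP, LinearMap.neg_apply, neg_inj]
  obtain ⟨B, hB, hΘB, hBΘ, hBinj⟩ :=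
    UnitaryThetaCore.exists_lower_injOn hbr hirr hnΘ hnΘΘ hP' hQ' hQ2 (by rw [hP2])
  rw [neg_mul, neg_inj] at hΘB
  rw [mul_neg, neg_eq_iff_eq_neg] at hBΘ
  -- values and kernels of `C`, `B`
  have hCQ : ∀ x, C x ∈ Q := fun x => by
    rw [hQ, ← Module.End.mul_apply, hΘC, LinearMap.neg_apply]
  have hCkill : ∀ x ∈ Q, C x = 0 := fun x hx => by
    have h := congr_arg (fun f : Module.End ℂ W => f x) hCΘ
    simp only [Module.End.mul_apply, (hQ x).1 hx, map_neg] at h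
    exact UnitaryThetaTwoTwo.eq_zero_of_neg_eq_self' h
  have hBP : ∀ x, B x ∈ P := fun x => by
    rw [hP, ← Module.End.mul_apply, hΘB]
  have hBkill : ∀ x ∈ P, B x = 0 := fun x hx => by
    have h := congr_arg (fun f : Module.End ℂ W => f x) hBΘ
    simp only [Module.End.mul_apply, (hP x).1 hx, LinearMap.neg_apply] at h
    exact UnitaryThetaTwoTwo.eq_zero_of_neg_eq_self' h.symm
  have hPQ : Disjoint P Q := by
    rw [Submodule.disjoint_def]
    intro x hxP hxQ
    have h1 := (hP x).1 hxP
    have h2 := (hQ x).1 hxQ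
    rw [h1] at h2
    exact UnitaryThetaTwoTwo.eq_zero_of_neg_eq_self' h2.symm
  have hPQtop : P ⊔ Q = ⊤ := by
    rw [eq_top_iff]
    intro x _
    have hx : x = (2 : ℂ)⁻¹ • (x + Θ x) + (2 : ℂ)⁻¹ • (x - Θ x) := by module
    rw [hx]
    refine Submodule.add_mem _ (Submodule.mem_sup_left (Submodule.smul_mem _ _ ?_))
      (Submodule.mem_sup_right (Submodule.smul_mem _ _ ?_))
    · rw [hP, map_add, hΘΘv, add_comm]
    · rw [hQ, map_sub, hΘΘv, neg_sub]
  have hW4 : Module.finrank ℂ W = 4 := by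
    have h := Submodule.finrank_sup_add_finrank_inf_eq P Q
    rw [hPQtop, finrank_top, hPQ.eq_bot, finrank_bot, add_zero, hP2, hQ2] at h
    exact h
  -- the adapted basis `(p₁, p₂, Cp₁, Cp₂)`
  set pB : Basis (Fin 2) ℂ P := Module.finBasisOfFinrankEq ℂ P hP2 with hpB
  set v : Fin 2 ⊕ Fin 2 → W := Sum.elim (fun i => (pB i : W)) (fun i => C (pB i)) with hv
  have hv_inl : ∀ i, v (Sum.inl i) = (pB i : W) := fun i => rfl
  have hv_inr : ∀ i, v (Sum.inr i) = C (pB i) := fun i => rfl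
  have hli : LinearIndependent ℂ v := by
    rw [hv]
    refine LinearIndependent.sum_type ?_ ?_ ?_
    · exact pB.linearIndependent.map' P.subtype (Submodule.ker_subtype P)
    · rw [linearIndependent_iff']
      intro s c hc i hi
      have hsum : C (∑ j ∈ s, c j • (pB j : W)) = 0 := by
        rw [map_sum]; simp_rw [map_smul]; exact hc
      have hmemP : (∑ j ∈ s, c j • (pB j : W)) ∈ P :=
        Submodule.sum_mem _ fun j _ => Submodule.smul_mem _ _ (pB j).2
      have h0 := hCinj _ hmemP hsum
      have h0' : (∑ j ∈ s, c j • pB j : P) = 0 := by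
        apply Subtype.ext
        rw [Submodule.coe_sum]; simpa using h0
      exact linearIndependent_iff'.1 pB.linearIndependent s c h0' i hi
    · refine hPQ.mono ?_ ?_
      · rw [Submodule.span_le]; rintro _ ⟨i, rfl⟩; exact (pB i).2
      · rw [Submodule.span_le]; rintro _ ⟨i, rfl⟩; exact hCQ _
  set b : Basis (Fin 2 ⊕ Fin 2) ℂ W := basisOfLinearIndependentOfCardEqFinrank hli (by rw [hW4]; rfl) with hbdef
  have hb : ∀ i, b i = v i := fun i => by rw [hbdef, coe_basisOfLinearIndependentOfCardEqFinrank]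
  -- coordinates of vectors of `P` vanish on the `inr` indices
  have hreprP : ∀ x ∈ P, ∀ i, b.repr x (Sum.inr i) = 0 := by
    intro x hx i
    have h := congr_arg (fun y : P => (y : W)) (pB.sum_repr ⟨x, hx⟩)
    simp only [Submodule.coe_sum, Submodule.coe_smul] at h
    have hx' : b.repr x = ∑ j, (pB.repr ⟨x, hx⟩ j) • Finsupp.single (Sum.inl j) (1 : ℂ) := by
      conv_lhs => rw [← h]
      rw [map_sum]
      refine Finset.sum_congr rfl fun j _ => ?_
      rw [map_smul, ← hv_inl, ← hb, b.repr_self]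
    rw [hx']
    simp
  -- the matrix dictionary
  set T := LinearMap.toMatrix b b with hT
  have hTmul : ∀ X Z : Module.End ℂ W, T (X * Z) = T X * T Z := fun X Z => LinearMap.toMatrix_mul b X Z
  have hTC : T C = Matrix.fromBlocks 0 0 (1 : Matrix (Fin 2) (Fin 2) ℂ) 0 := by
    ext i j
    rw [hT, LinearMap.toMatrix_apply]
    rcases j with j | j
    · rw [hb, hv_inl, ← hv_inr, ← hb, b.repr_self]
      rcases i with i | i
      · simp
      · simp [Finsupp.single_apply, Matrix.one_apply, eq_comm]
    · rw [hb, hv_inr, hCkill _ (hCQ _), map_zero]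
      rcases i with i | i <;> simp
  set β₀ : Matrix (Fin 2) (Fin 2) ℂ := Matrix.of fun i j => b.repr (B (b (Sum.inr j))) (Sum.inl i) with hβ₀
  have hTB : T B = Matrix.fromBlocks 0 β₀ 0 0 := by
    ext i j
    rw [hT, LinearMap.toMatrix_apply]
    rcases j with j | j
    · rw [hb, hv_inl, hBkill _ (pB j).2, map_zero]
      rcases i with i | i <;> simp
    · rcases i with i | i
      · simp [hβ₀]
      · simp [hreprP _ (hBP _)]
  have hβ₀det : β₀.det ≠ 0 := by
    intro hdet
    obtain ⟨c, hc0, hc⟩ := Matrix.exists_mulVec_eq_zero_iff.2 hdet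
    set q : W := b.equivFun.symm (Sum.elim (0 : Fin 2 → ℂ) c) with hq
    have hqrepr : ⇑(b.repr q) = Sum.elim (0 : Fin 2 → ℂ) c := by
      rw [← b.equivFun_apply, hq, LinearEquiv.apply_symm_apply]
    have hqQ : q ∈ Q := by
      rw [hq, Basis.equivFun_symm_apply]
      refine Submodule.sum_mem _ fun i _ => ?_
      rcases i with i | i
      · simp
      · exact Submodule.smul_mem _ _ (by rw [hb, hv_inr]; exact hCQ _)
    have hBq : B q = 0 := by
      have h := LinearMap.toMatrix_mulVec_repr b b B q
      rw [hqrepr, ← hT, hTB, fromBlocks_mulVec] at h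
      have h' : ⇑(b.repr (B q)) = 0 := by
        rw [← h]; ext i; rcases i with i | i <;> simp [hc]
      have : b.repr (B q) = 0 := Finsupp.ext fun i => congr_fun h' i
      exact b.repr.map_eq_zero_iff.1 this
    have hq0 := hBinj q hqQ hBq
    apply hc0
    have : Sum.elim (0 : Fin 2 → ℂ) c = 0 := by rw [← hqrepr, hq0, map_zero]; rfl
    ext i
    simpa using congr_fun this (Sum.inr i)
  -- the image `𝔐` of `𝔊`
  set 𝔐 : Submodule ℂ (Matrix (Fin 2 ⊕ Fin 2) (Fin 2 ⊕ Fin 2) ℂ) := 𝔊.map T.toLinearMap with h𝔐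
  have hmem𝔐 : ∀ {m}, m ∈ 𝔐 ↔ ∃ X ∈ 𝔊, T X = m := fun {m} => by
    rw [h𝔐, Submodule.mem_map]; rfl
  have hT𝔐 : ∀ {X}, X ∈ 𝔊 → T X ∈ 𝔐 := fun {X} hX => hmem𝔐.2 ⟨X, hX, rfl⟩
  have hbr' : ∀ m₁ ∈ 𝔐, ∀ m₂ ∈ 𝔐, m₁ * m₂ - m₂ * m₁ ∈ 𝔐 := by
    intro m₁ hm₁ m₂ hm₂
    obtain ⟨X, hX, rfl⟩ := hmem𝔐.1 hm₁
    obtain ⟨Z, hZ, rfl⟩ := hmem𝔐.1 hm₂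
    rw [← hTmul, ← hTmul, ← map_sub]
    exact hT𝔐 (hbr X hX Z hZ)
  have hsl' : ∀ m ∈ 𝔐, Matrix.trace m = 0 := by
    intro m hm
    obtain ⟨X, hX, rfl⟩ := hmem𝔐.1 hm
    rw [hT, ← LinearMap.trace_eq_matrix_trace ℂ b X]
    exact hsl X hX
  have hirr' : ∀ U : Submodule ℂ (Fin 2 ⊕ Fin 2 → ℂ), (∀ m ∈ 𝔐, ∀ w ∈ U, m *ᵥ w ∈ U) → U = ⊥ ∨ U = ⊤ := by
    intro U hU
    set U' : Submodule ℂ W := U.comap (b.equivFun : W ≃ₗ[ℂ] (Fin 2 ⊕ Fin 2 → ℂ)).toLinearMap with hU'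
    have hU'mem : ∀ x, x ∈ U' ↔ ⇑(b.repr x) ∈ U := fun x => by
      rw [hU', Submodule.mem_comap]; simp [Basis.equivFun_apply]
    have hstab : ∀ A ∈ 𝔊, ∀ u ∈ U', A u ∈ U' := by
      intro A hA u hu
      rw [hU'mem] at hu ⊢
      have h := LinearMap.toMatrix_mulVec_repr b b A u
      rw [← h]
      exact hU _ (hT𝔐 hA) _ hu
    rcases hirr U' hstab with h | h
    · left
      rw [eq_bot_iff]
      intro w hw
      have hw' : b.equivFun.symm w ∈ U' := by
        rw [hU'mem, ← b.equivFun_apply, LinearEquiv.apply_symm_apply]; exact hw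
      rw [h, Submodule.mem_bot] at hw'
      rw [Submodule.mem_bot, ← b.equivFun.apply_symm_apply w, hw', map_zero]
    · right
      rw [eq_top_iff]
      intro w _
      have hw' : b.equivFun.symm w ∈ U' := by rw [h]; exact Submodule.mem_top
      rw [hU'mem, ← b.equivFun_apply, LinearEquiv.apply_symm_apply] at hw'
      exact hw'
  have hND' : ∀ G : Matrix (Fin 2 ⊕ Fin 2) (Fin 2 ⊕ Fin 2) ℂ, (∀ m ∈ 𝔐, mᵀ * G + G * m = 0) → G = 0 := by
    intro G hG
    set bf : LinearMap.BilinForm ℂ W := Matrix.toBilin b G with hbf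
    have hbfG : LinearMap.BilinForm.toMatrix b bf = G := by rw [hbf, LinearMap.BilinForm.toMatrix_toBilin]
    have hbf0 : bf = 0 := hND bf fun X hX u w => by
      have h := hG _ (hT𝔐 hX)
      rw [hT, ← hbfG, ← LinearMap.BilinForm.toMatrix_compLeft, ← LinearMap.BilinForm.toMatrix_compRight,
        ← map_add, LinearEquiv.map_eq_zero_iff] at h
      have h' := congr_fun (congr_arg (fun f : LinearMap.BilinForm ℂ W => ⇑(f u)) h) w
      simpa [LinearMap.BilinForm.compLeft_apply, LinearMap.BilinForm.compRight_apply] using h'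
    rw [← hbfG, hbf0, map_zero]
  -- conclusion
  have hTY : T Y ∈ 𝔐 :=
    UnitaryThetaTwoTwo.mem_of_trace_eq_zero hbr' hsl' (hTC ▸ hT𝔐 hC) ⟨β₀, hβ₀det, hTB ▸ hT𝔐 hB⟩ hirr' hND'
      (by rw [hT, ← LinearMap.trace_eq_matrix_trace ℂ b Y]; exact hY)
  obtain ⟨X, hX, hXY⟩ := hmem𝔐.1 hTY
  rw [← T.injective hXY]
  exact hX

end Abstract

/-! ### §2 The Hodge-theoretic form: `𝔤_ℂ ⊇ 𝔰𝔲_K(V, ψ)_ℂ` for an imaginary quadratic `K` acting with multiplicities `(2,2)` -/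

section Hodge

universe u

variable {V : Type u} [AddCommGroup V] [Module ℚ V] {n : ℤ}

/-- A `B`-skew operator `Y` of a finite-dimensional space with `B` non-degenerate is traceless: `B♭ ∘ Y = -Yᵗ ∘ B♭`,
so `Y` is conjugate to `-Yᵗ` and `tr Y = -tr Y`. [folklore] -/
private theorem UnitaryThetaTwoTwo.trace_eq_zero_of_skew {M : Type*} [AddCommGroup M] [Module ℂ M]
    [FiniteDimensional ℂ M] {B : LinearMap.BilinForm ℂ M} (hB : B.Nondegenerate) {Y : Module.End ℂ M}
    (hY : ∀ x y, B (Y x) y + B x (Y y) = 0) : LinearMap.trace ℂ M Y = 0 := by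
  have hconj : Y = (B.toDual hB).symm.conj (-Y.dualMap) := by
    refine LinearMap.ext fun x => (B.toDual hB).injective (LinearMap.ext fun z => ?_)
    simp only [LinearEquiv.conj_apply, LinearEquiv.symm_symm, LinearMap.comp_apply, LinearEquiv.coe_coe,
      LinearEquiv.apply_symm_apply, LinearMap.neg_apply, LinearMap.dualMap_apply,
      LinearMap.BilinForm.toDual_def]
    linear_combination hY x z
  have h1 : LinearMap.trace ℂ M Y = -LinearMap.trace ℂ M Y := by
    conv_lhs => rw [hconj]
    rw [LinearMap.trace_conj', map_neg]
    exact congrArg Neg.neg (LinearMap.trace_transpose' (R := ℂ) Y)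
  linear_combination h1 / 2

/-- The complex span of operators `X_ℂ` with `tr(c X) = 0` consists of operators `Z` with `tr(c_ℂ Z) = 0` (linearity of
the trace; the tree's `trace_baseChange_mul_eq_zero_of_mem_spanC` of `Motives/HodgeLieRigidityTraceCriterion`, restated to
keep the imports of this file small). [folklore] -/
private theorem UnitaryThetaTwoTwo.trace_baseChange_mul_eq_zero_of_mem_spanC [Module.Finite ℚ V]
    (𝔤 : Submodule ℚ (Module.End ℚ V)) {c : Module.End ℚ V} (hc : ∀ X ∈ 𝔤, LinearMap.trace ℚ V (c * X) = 0) {Z : Module.End ℂ (ℂ ⊗[ℚ] V)}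
    (hZ : Z ∈ spanC 𝔤) : LinearMap.trace ℂ (ℂ ⊗[ℚ] V) (c.baseChange ℂ * Z) = 0 := by
  induction hZ using Submodule.span_induction with
  | mem Z hZ =>
    obtain ⟨X, hX, rfl⟩ := hZ
    rw [← LinearMap.baseChange_mul, LinearMap.trace_baseChange, hc X hX, map_zero]
  | zero => rw [mul_zero, map_zero]
  | add Z Z' _ _ hZ hZ' => rw [mul_add, map_add, hZ, hZ', add_zero]
  | smul a Z _ hZ => rw [mul_smul_comm, map_smul, hZ, smul_zero]

/-- **Traces on `W`.** For `V_ℂ = W ⊕ W'` (`W`, `W'` the `±μ`-eigenspaces of `φ_ℂ`, `φ² = -d`, `μ² = -d`), an operator `Z`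
commuting with `φ_ℂ` with `tr Z = 0` and `tr(φ_ℂ Z) = 0` has traceless restriction to `W`: `0 = tr_W Z + tr_{W'} Z` and
`0 = μ tr_W Z − μ tr_{W'} Z`. [folklore] -/
private theorem UnitaryThetaTwoTwo.trace_restrict_eq_zero [Module.Finite ℚ V] {φ : Module.End ℚ V} {d : ℚ}
    (hφ2 : φ * φ = -(d • 1)) {μ : ℂ} (hμ : μ ^ 2 = -(d : ℂ)) (hμ0 : μ ≠ 0) {Z : Module.End ℂ (ℂ ⊗[ℚ] V)}
    (hZφ : Z * φ.baseChange ℂ = φ.baseChange ℂ * Z) (htr : LinearMap.trace ℂ (ℂ ⊗[ℚ] V) Z = 0)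
    (htrφ : LinearMap.trace ℂ (ℂ ⊗[ℚ] V) (φ.baseChange ℂ * Z) = 0)
    (hZW : ∀ w ∈ Module.End.eigenspace (φ.baseChange ℂ) μ, Z w ∈ Module.End.eigenspace (φ.baseChange ℂ) μ) :
    LinearMap.trace ℂ ↥(Module.End.eigenspace (φ.baseChange ℂ) μ) (Z.restrict hZW) = 0 := by
  classical
  set W := Module.End.eigenspace (φ.baseChange ℂ) μ with hWdef
  set W' := Module.End.eigenspace (φ.baseChange ℂ) (-μ) with hW'def
  have hZW' : ∀ w ∈ W', Z w ∈ W' := fun w hw => UnitaryTheta.apply_mem_eigenspace_of_commute hZφ hw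
  have hφZφ : (φ.baseChange ℂ * Z) * φ.baseChange ℂ = φ.baseChange ℂ * (φ.baseChange ℂ * Z) := by
    rw [mul_assoc, hZφ]
  have hφZW : ∀ w ∈ W, (φ.baseChange ℂ * Z) w ∈ W := fun w hw =>
    UnitaryTheta.apply_mem_eigenspace_of_commute hφZφ hw
  have hφZW' : ∀ w ∈ W', (φ.baseChange ℂ * Z) w ∈ W' := fun w hw =>
    UnitaryTheta.apply_mem_eigenspace_of_commute hφZφ hw
  have hc : IsCompl W W' := by
    refine ⟨disjoint_iff.2 (eq_bot_iff.2 fun x hx => ?_), codisjoint_iff.2 (eq_top_iff.2 fun v _ => ?_)⟩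
    · rw [Submodule.mem_bot]
      exact UnitaryTheta.eq_zero_of_mem_eigenspace_of_mem_eigenspace_neg hμ0 (Submodule.mem_inf.1 hx).1
        (Submodule.mem_inf.1 hx).2
    · obtain ⟨w, hw, w', hw', rfl⟩ := UnitaryTheta.exists_eigen_add_eigen hφ2 hμ hμ0 v
      exact Submodule.add_mem_sup hw hw'
  let N' : Bool → Submodule ℂ (ℂ ⊗[ℚ] V) := fun b => cond b W W'
  have hint : DirectSum.IsInternal N' :=
    (DirectSum.isInternal_submodule_iff_isCompl N' (i := true) (j := false) (by decide)
      (Set.eq_univ_of_forall fun b => by cases b <;> simp).symm).2 hc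
  have hmaps : ∀ b, Set.MapsTo Z (N' b) (N' b) := fun b =>
    match b with
    | true => hZW
    | false => hZW'
  have hmapsφ : ∀ b, Set.MapsTo (φ.baseChange ℂ * Z) (N' b) (N' b) := fun b =>
    match b with
    | true => hφZW
    | false => hφZW'
  have hs1 := LinearMap.trace_eq_sum_trace_restrict hint hmaps
  have hs2 := LinearMap.trace_eq_sum_trace_restrict hint hmapsφ
  rw [Fintype.sum_bool] at hs1 hs2
  have hs1' : LinearMap.trace ℂ (ℂ ⊗[ℚ] V) Z =
      LinearMap.trace ℂ W (Z.restrict hZW) + LinearMap.trace ℂ W' (Z.restrict hZW') := hs1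
  have hs2' : LinearMap.trace ℂ (ℂ ⊗[ℚ] V) (φ.baseChange ℂ * Z) =
      LinearMap.trace ℂ W ((φ.baseChange ℂ * Z).restrict hφZW) +
        LinearMap.trace ℂ W' ((φ.baseChange ℂ * Z).restrict hφZW') := hs2
  have hr1 : (φ.baseChange ℂ * Z).restrict hφZW = μ • Z.restrict hZW :=
    LinearMap.ext fun w => Subtype.ext (by
      simp only [LinearMap.coe_restrict_apply, LinearMap.smul_apply, Submodule.coe_smul, Module.End.mul_apply]
      exact Module.End.mem_eigenspace_iff.1 (hZW w w.2))
  have hr2 : (φ.baseChange ℂ * Z).restrict hφZW' = (-μ) • Z.restrict hZW' :=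
    LinearMap.ext fun w => Subtype.ext (by
      simp only [LinearMap.coe_restrict_apply, LinearMap.smul_apply, Submodule.coe_smul, Module.End.mul_apply]
      exact Module.End.mem_eigenspace_iff.1 (hZW' w w.2))
  rw [hr1, hr2, map_smul, map_smul, smul_eq_mul, smul_eq_mul, htrφ] at hs2'
  rw [htr] at hs1'
  have h2 : 2 * μ * LinearMap.trace ℂ W (Z.restrict hZW) = 0 := by linear_combination -μ * hs1' - hs2'
  exact (mul_eq_zero.1 h2).resolve_left (mul_ne_zero two_ne_zero hμ0)

/-- **`𝔤_ℂ ⊇ 𝔰𝔲_K(V, ψ)_ℂ` for multiplicities `(2,2)` — the Hodge-theoretic form of §1.** Let `H` be an effective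
polarizable `ℚ`-Hodge structure of weight `1` with polarization `ψ`, `End_Hdg(V) = ℚ + ℚφ` with `φ² = -d`, `d > 0`
(`End⁰ = K` imaginary quadratic), `μ² = -d`, `W = ker(φ_ℂ − μ)`, and assume the MULTIPLICITY HYPOTHESIS
`dim W^{1,0} = dim W^{0,1} = 2`. Let `𝔤 ⊆ 𝔰𝔲_K(V, ψ)` be a bracket-closed `ℚ`-subspace — its elements commute with
`End_Hdg(V)`, are `ψ`-skew and `K`-traceless (`Tr(φX) = 0`; `Tr X = 0` is automatic for `ψ`-skew `X`) — whose complex span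
contains an operator `Θ` acting by `2p − 1` on `V^{p,1−p}`. Then every `Y ∈ 𝔰𝔲_K(V,ψ)_ℂ` — `Y` commuting with `φ_ℂ`,
`ψ_ℂ`-skew, `tr(φ_ℂ Y) = 0` — lies in `𝔤_ℂ`. Proof: the restrictions of `𝔤_ℂ` to `W` form a bracket-closed
`𝔊 ⊆ 𝔰𝔩(W)` (`trace_restrict_eq_zero`) containing the involution `Θ|_W` with eigenspaces `W^{1,0}`, `W^{0,1}` of dimension
`2`, acting irreducibly (`UnitaryTheta.eq_bot_or_eq_of_stable`) and leaving no bilinear form on `W` invariant: such a form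
`b` gives, through the projection `π = (2μ)⁻¹(μ + φ_ℂ) : V_ℂ → W` and the duality `ψ_ℂ♭`, an operator `T` with
`ψ_ℂ(Ty, x) = b(πx, πy)` commuting with every `X_ℂ`, `X ∈ 𝔤`, hence `T ∈ End_Hdg ⊗ ℂ = ℂ + ℂφ_ℂ`
(`ThetaSubalgebra.mem_span_endAlg_of_forall_commute`), so `b(u, v) = (α + βμ) ψ_ℂ(v, u) = 0` on `W × W` (`W` is
`ψ_ℂ`-isotropic). By §1, `𝔊 = 𝔰𝔩(W)`; then `Y|_W = Z|_W` for some `Z ∈ 𝔤_ℂ`, and `Z = Y` by determination on `W`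
(`UnitaryTheta.eq_zero_of_forall_mem_eigenspace`). In the Hodge application (`𝔤 ⊆ Lie Hg`, Moonen–Zarhin: a simple
abelian fourfold of type IV(1,1) with `End⁰ = K` of signature `(2,2)` has «`Hg = SU(V,ψ)`») the hypothesis `𝔤 ⊆ 𝔰𝔲_K` is
where `n' = n''` enters. [cite: MoonenZarhin1999LowDim, §2 (2.5) (2)] [cite: MoonenZarhin1995Duke, main theorem (type IV(1,1), (2,2))]
[cite: vanGeemen1994HodgeAV, Thm. 6.11 and Lemma 6.10] [cite: Ribet1983, Thm. 3] [cite: Gordon1997, Thm. 6.3.3 and §6 (pp. 18–19)] -/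
theorem UnitaryThetaTwoTwo.mem_spanC_of_commute_of_skew [Module.Finite ℚ V] (H : HodgeStructure V n)
    (hn : n = 1) (heff : H.IsEffective) (ψ : H.Polarization) {φ : Module.End ℚ V} (hφE : φ ∈ H.endAlg)
    {d : ℚ} (hd : 0 < d) (hφ2 : φ * φ = -(d • 1)) (hE : ∀ a ∈ H.endAlg, ∃ x y : ℚ, a = x • 1 + y • φ)
    {μ : ℂ} (hμ : μ ^ 2 = -(d : ℂ))
    (h22 : Module.finrank ℂ ↥(Module.End.eigenspace (φ.baseChange ℂ) μ ⊓ H.piece 1 0) = 2 ∧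
        Module.finrank ℂ ↥(Module.End.eigenspace (φ.baseChange ℂ) μ ⊓ H.piece 0 1) = 2)
    (𝔤 : Submodule ℚ (Module.End ℚ V)) (hbr : ∀ X ∈ 𝔤, ∀ X' ∈ 𝔤, X * X' - X' * X ∈ 𝔤)
    {Θ : Module.End ℂ (ℂ ⊗[ℚ] V)} (hΘ : ∀ p, ∀ x ∈ H.piece p (n - p), Θ x = ((2 * p - n : ℤ) : ℂ) • x)
    (hΘ𝔤 : Θ ∈ spanC 𝔤)
    (hcomm : ∀ X ∈ 𝔤, ∀ a : H.endAlg, X * (a : Module.End ℚ V) = (a : Module.End ℚ V) * X)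
    (hskew : ∀ X ∈ 𝔤, ∀ v w, ψ.form (X v) w + ψ.form v (X w) = 0)
    (hsu : ∀ X ∈ 𝔤, LinearMap.trace ℚ V (φ * X) = 0)
    {Y : Module.End ℂ (ℂ ⊗[ℚ] V)} (hYφ : Y * φ.baseChange ℂ = φ.baseChange ℂ * Y)
    (hYskew : ∀ x y, ψ.form.baseChange ℂ (Y x) y + ψ.form.baseChange ℂ x (Y y) = 0)
    (hYsu : LinearMap.trace ℂ (ℂ ⊗[ℚ] V) (φ.baseChange ℂ * Y) = 0) :
    Y ∈ spanC 𝔤 := by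
  classical
  obtain ⟨hPhat, hQhat, hΘ10, hΘ01, hΘΘ⟩ := UnitaryTheta.theta_facts H hn heff hΘ
  obtain ⟨hμ0, -⟩ := UnitaryTheta.conj_eq_neg_of_sq hd hμ
  set φC := φ.baseChange ℂ with hφCdef
  set ψC := ψ.form.baseChange ℂ with hψCdef
  set W := Module.End.eigenspace φC μ with hWdef
  have hN : ψC.Nondegenerate :=
    ⟨fun _ hx => ψ.eq_zero_of_forall_form_eq_zero hx, fun _ hy => ψ.eq_zero_of_forall_form_eq_zero' hy⟩
  have h𝔊W : ∀ Z ∈ spanC 𝔤, ∀ s ∈ W, Z s ∈ W := fun Z hZ s hs =>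
    UnitaryTheta.apply_mem_eigenspace_of_commute (UnitaryTheta.commute_of_mem_spanC H hφE hcomm hZ) hs
  have h𝔊br : ∀ Z ∈ spanC 𝔤, ∀ Z' ∈ spanC 𝔤, Z * Z' - Z' * Z ∈ spanC 𝔤 := fun Z hZ Z' hZ' =>
    commutator_mem_spanC hbr hZ hZ'
  -- a non-zero vector of `W`, hence `V` is nontrivial
  have hWpos : 0 < Module.finrank ℂ ↥(W ⊓ H.piece 1 0) := by rw [h22.1]; exact two_pos
  haveI : Nontrivial ↥(W ⊓ H.piece 1 0) := Module.nontrivial_of_finrank_pos (R := ℂ) hWpos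
  obtain ⟨⟨x₀, hx₀⟩, hx₀0⟩ := exists_ne (0 : ↥(W ⊓ H.piece 1 0))
  have hx₀0' : x₀ ≠ 0 := fun h => hx₀0 (Subtype.ext h)
  haveI : Nontrivial V := by
    by_contra hV
    have hsub : Subsingleton V := not_nontrivial_iff_subsingleton.1 hV
    have hzero : ∀ x : ℂ ⊗[ℚ] V, x = 0 := fun x => by
      induction x using TensorProduct.induction_on with
      | zero => rfl
      | tmul c v => rw [Subsingleton.elim v 0, TensorProduct.tmul_zero]
      | add x y hx hy => rw [hx, hy, add_zero]
    exact hx₀0' (hzero x₀)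
  have hφskew : ∀ x y, ψC (φC x) y + ψC x (φC y) = 0 :=
    ThetaSubalgebra.formBaseChange_add_eq_zero_of_skew ψ
      (UnitaryTheta.form_apply_add_form_apply_eq_zero H ψ hφE hd hφ2 hE)
  -- the restricted Lie algebra `𝔊 ⊆ End(W)`
  set 𝔊 : Submodule ℂ (Module.End ℂ W) :=
    { carrier := {F | ∃ Z ∈ spanC 𝔤, ∀ w : W, (F w : ℂ ⊗[ℚ] V) = Z w}
      zero_mem' := ⟨0, Submodule.zero_mem _, fun w => by simp⟩
      add_mem' := by
        rintro F F' ⟨Z, hZ, hF⟩ ⟨Z', hZ', hF'⟩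
        exact ⟨Z + Z', Submodule.add_mem _ hZ hZ', fun w => by
          rw [LinearMap.add_apply, Submodule.coe_add, hF, hF', LinearMap.add_apply]⟩
      smul_mem' := by
        rintro c F ⟨Z, hZ, hF⟩
        exact ⟨c • Z, Submodule.smul_mem _ c hZ, fun w => by
          rw [LinearMap.smul_apply, Submodule.coe_smul, hF, LinearMap.smul_apply]⟩ } with h𝔊def
  have hmem𝔊 : ∀ F, F ∈ 𝔊 ↔ ∃ Z ∈ spanC 𝔤, ∀ w : W, (F w : ℂ ⊗[ℚ] V) = Z w := fun F => Iff.rfl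
  have hres : ∀ Z ∈ spanC 𝔤, ∃ F ∈ 𝔊, ∀ w : W, (F w : ℂ ⊗[ℚ] V) = Z w := fun Z hZ =>
    ⟨Z.restrict fun s hs => h𝔊W Z hZ s hs, ⟨Z, hZ, fun w => rfl⟩, fun w => rfl⟩
  have hbr𝔊 : ∀ F ∈ 𝔊, ∀ F' ∈ 𝔊, F * F' - F' * F ∈ 𝔊 := by
    intro F hF F' hF'
    obtain ⟨Z, hZ, hFZ⟩ := (hmem𝔊 F).1 hF
    obtain ⟨Z', hZ', hFZ'⟩ := (hmem𝔊 F').1 hF'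
    refine (hmem𝔊 _).2 ⟨Z * Z' - Z' * Z, h𝔊br Z hZ Z' hZ', fun w => ?_⟩
    rw [LinearMap.sub_apply, Submodule.coe_sub, Module.End.mul_apply, Module.End.mul_apply, hFZ, hFZ', hFZ', hFZ,
      LinearMap.sub_apply, Module.End.mul_apply, Module.End.mul_apply]
  -- `𝔊 ⊆ 𝔰𝔩(W)`
  have hsl𝔊 : ∀ F ∈ 𝔊, LinearMap.trace ℂ W F = 0 := by
    intro F hF
    obtain ⟨Z, hZ, hFZ⟩ := (hmem𝔊 F).1 hF
    have hZW : ∀ w ∈ W, Z w ∈ W := h𝔊W Z hZ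
    have hFeq : F = Z.restrict hZW := LinearMap.ext fun w => Subtype.ext (by rw [hFZ]; rfl)
    rw [hFeq]
    exact UnitaryThetaTwoTwo.trace_restrict_eq_zero hφ2 hμ hμ0 (UnitaryTheta.commute_of_mem_spanC H hφE hcomm hZ)
      (UnitaryThetaTwoTwo.trace_eq_zero_of_skew hN
        (ThetaSubalgebra.formBaseChange_add_eq_zero_of_mem_spanC ψ hskew hZ))
      (UnitaryThetaTwoTwo.trace_baseChange_mul_eq_zero_of_mem_spanC 𝔤 hsu hZ) hZW
  -- `Θ|_W`
  set ΘW : Module.End ℂ W := Θ.restrict fun s hs => h𝔊W Θ hΘ𝔤 s hs with hΘWdef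
  have hΘWapply : ∀ w : W, (ΘW w : ℂ ⊗[ℚ] V) = Θ w := fun w => rfl
  have hΘW𝔊 : ΘW ∈ 𝔊 := (hmem𝔊 _).2 ⟨Θ, hΘ𝔤, hΘWapply⟩
  have hΘWΘW : ΘW * ΘW = 1 := LinearMap.ext fun w => Subtype.ext (by
    rw [Module.End.mul_apply, hΘWapply, hΘWapply, hΘΘ, Module.End.one_apply])
  -- irreducibility of `W` under `𝔊`
  have hirr𝔊 : ∀ U : Submodule ℂ W, (∀ F ∈ 𝔊, ∀ u ∈ U, F u ∈ U) → U = ⊥ ∨ U = ⊤ := by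
    intro U hU
    have hU' : ∀ X ∈ 𝔤, ∀ u ∈ U.map W.subtype, X.baseChange ℂ u ∈ U.map W.subtype := by
      rintro X hX _ ⟨u, hu, rfl⟩
      obtain ⟨F, hF, hFZ⟩ := hres _ (baseChange_mem_spanC hX)
      exact ⟨F u, hU F hF u hu, hFZ u⟩
    rcases UnitaryTheta.eq_bot_or_eq_of_stable H hn heff ψ hφE hd hφ2 hE hμ 𝔤 hΘ hΘ𝔤 hcomm hskew
        (U := U.map W.subtype) (Submodule.map_subtype_le W U) hU' with h | h
    · left
      rw [eq_bot_iff]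
      intro u hu
      rw [Submodule.mem_bot]
      apply Subtype.ext
      have : (u : ℂ ⊗[ℚ] V) ∈ U.map W.subtype := ⟨u, hu, rfl⟩
      rw [h, Submodule.mem_bot] at this
      exact this
    · right
      rw [eq_top_iff]
      intro w _
      have hw : (w : ℂ ⊗[ℚ] V) ∈ U.map W.subtype := by rw [h]; exact w.2
      obtain ⟨u, hu, huw⟩ := hw
      have : u = w := Subtype.ext huw
      exact this ▸ hu
  -- the eigenspaces of `Θ|_W` and their dimensions
  set PW : Submodule ℂ W := LinearMap.ker (ΘW - 1) with hPWdef
  set QW : Submodule ℂ W := LinearMap.ker (ΘW + 1) with hQWdef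
  have hPW : ∀ x, x ∈ PW ↔ ΘW x = x := fun x => by
    rw [hPWdef, LinearMap.mem_ker, LinearMap.sub_apply, Module.End.one_apply, sub_eq_zero]
  have hQW : ∀ x, x ∈ QW ↔ ΘW x = -x := fun x => by
    rw [hQWdef, LinearMap.mem_ker, LinearMap.add_apply, Module.End.one_apply, add_eq_zero_iff_eq_neg]
  have hPWeq : PW = Submodule.comap W.subtype (W ⊓ H.piece 1 0) := by
    ext x
    rw [hPW, Submodule.mem_comap, Submodule.subtype_apply, Submodule.mem_inf]
    constructor
    · intro h
      have hx : Θ x = x := by rw [← hΘWapply, h]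
      refine ⟨x.2, ?_⟩
      have hx' : (x : ℂ ⊗[ℚ] V) = (2 : ℂ)⁻¹ • ((x : ℂ ⊗[ℚ] V) + Θ x) := by rw [hx]; module
      rw [hx']
      exact hPhat _
    · rintro ⟨-, hx10⟩
      apply Subtype.ext
      rw [hΘWapply]
      exact hΘ10 _ hx10
  have hQWeq : QW = Submodule.comap W.subtype (W ⊓ H.piece 0 1) := by
    ext x
    rw [hQW, Submodule.mem_comap, Submodule.subtype_apply, Submodule.mem_inf]
    constructor
    · intro h
      have hx : Θ x = -x := by rw [← hΘWapply, h, Submodule.coe_neg]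
      refine ⟨x.2, ?_⟩
      have hx' : (x : ℂ ⊗[ℚ] V) = (2 : ℂ)⁻¹ • ((x : ℂ ⊗[ℚ] V) - Θ x) := by rw [hx]; module
      rw [hx']
      exact hQhat _
    · rintro ⟨-, hx01⟩
      apply Subtype.ext
      rw [hΘWapply, Submodule.coe_neg]
      exact hΘ01 _ hx01
  have hfinP : Module.finrank ℂ PW = 2 := by
    rw [hPWeq, ← h22.1]; exact (Submodule.comapSubtypeEquivOfLe inf_le_left).finrank_eq
  have hfinQ : Module.finrank ℂ QW = 2 := by
    rw [hQWeq, ← h22.2]; exact (Submodule.comapSubtypeEquivOfLe inf_le_left).finrank_eq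
  -- no `𝔊`-invariant bilinear form on `W`
  have hND𝔊 : ∀ b : LinearMap.BilinForm ℂ W, (∀ F ∈ 𝔊, ∀ u v, b (F u) v + b u (F v) = 0) → b = 0 := by
    intro b hb
    -- the projection `π = (2μ)⁻¹ (μ + φ_ℂ) : V_ℂ → W`
    have hdμ : (d : ℂ) = -μ ^ 2 := by rw [hμ, neg_neg]
    have hπmem : ∀ x, (2 * μ)⁻¹ • (μ • x + φC x) ∈ W := fun x => by
      rw [hWdef, Module.End.mem_eigenspace_iff, map_smul, map_add, map_smul, hφCdef,
        UnitaryTheta.baseChange_baseChange_apply hφ2, hdμ]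
      module
    set π : ℂ ⊗[ℚ] V →ₗ[ℂ] W :=
      LinearMap.codRestrict W ((2 * μ)⁻¹ • (μ • LinearMap.id + φC)) (fun x => by
        simpa using hπmem x) with hπdef
    have hπapply : ∀ x, (π x : ℂ ⊗[ℚ] V) = (2 * μ)⁻¹ • (μ • x + φC x) := fun x => by
      simp [hπdef]
    have hπW : ∀ w : W, π w = w := fun w => Subtype.ext (by
      rw [hπapply, Module.End.mem_eigenspace_iff.1 w.2, ← add_smul, ← two_mul, smul_smul,
        inv_mul_cancel₀ (mul_ne_zero two_ne_zero hμ0), one_smul])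
    have hπZ : ∀ Z ∈ spanC 𝔤, ∀ F ∈ 𝔊, (∀ w : W, (F w : ℂ ⊗[ℚ] V) = Z w) → ∀ x, π (Z x) = F (π x) := by
      intro Z hZ F hF hFZ x
      apply Subtype.ext
      have hc := UnitaryTheta.commute_of_mem_spanC H hφE hcomm hZ
      rw [← hφCdef] at hc
      rw [hFZ, hπapply, hπapply, map_smul, map_add, map_smul, ← Module.End.mul_apply, ← hc, Module.End.mul_apply]
    set bt : LinearMap.BilinForm ℂ (ℂ ⊗[ℚ] V) := b.compl₁₂ π π with hbtdef
    have hbt : ∀ x y, bt x y = b (π x) (π y) := fun x y => rfl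
    have hbtinv : ∀ Z ∈ spanC 𝔤, ∀ x y, bt (Z x) y + bt x (Z y) = 0 := by
      intro Z hZ x y
      obtain ⟨F, hF, hFZ⟩ := hres Z hZ
      rw [hbt, hbt, hπZ Z hZ F hF hFZ, hπZ Z hZ F hF hFZ]
      exact hb F hF _ _
    -- the operator `T` with `ψ_ℂ(T y, x) = bt(x, y)`
    set T : Module.End ℂ (ℂ ⊗[ℚ] V) := (ψC.toDual hN).symm.toLinearMap ∘ₗ bt.flip with hTdef
    have hT : ∀ x y, ψC (T y) x = bt x y := fun x y => by
      rw [hTdef, LinearMap.comp_apply, LinearEquiv.coe_coe, LinearMap.BilinForm.apply_toDual_symm_apply]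
      rfl
    have hTcomm : ∀ X ∈ 𝔤, T * X.baseChange ℂ = X.baseChange ℂ * T := by
      intro X hX
      have hXskew := ThetaSubalgebra.formBaseChange_add_eq_zero_of_skew ψ (hskew X hX)
      refine LinearMap.ext fun y => ?_
      rw [← sub_eq_zero, ← LinearMap.sub_apply]
      refine ψ.eq_zero_of_forall_form_eq_zero fun x => ?_
      rw [LinearMap.sub_apply, map_sub, LinearMap.sub_apply, Module.End.mul_apply, Module.End.mul_apply]
      have h1 := hbtinv _ (baseChange_mem_spanC hX) x y
      have h2 := hXskew (T y) x
      have h3 := hT x (X.baseChange ℂ y)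
      have h4 := hT (X.baseChange ℂ x) y
      rw [← hψCdef] at h2 ⊢
      linear_combination h3 - h2 + h4 + h1
    obtain ⟨α, β, hTeq⟩ := UnitaryTheta.exists_eq_of_mem_span_endAlg H hE
      (ThetaSubalgebra.mem_span_endAlg_of_forall_commute H 𝔤 hΘ hΘ𝔤 hTcomm)
    refine LinearMap.ext fun u => LinearMap.ext fun v => ?_
    rw [LinearMap.zero_apply, LinearMap.zero_apply]
    have h := hT u v
    rw [hbt, hπW, hπW] at h
    rw [← h, hTeq]
    have h0 : ψC (v : ℂ ⊗[ℚ] V) u = 0 := UnitaryTheta.form_eq_zero_of_mem_eigenspace hφskew hμ0 v.2 u.2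
    have hφv : φC v = μ • (v : ℂ ⊗[ℚ] V) := Module.End.mem_eigenspace_iff.1 v.2
    rw [LinearMap.add_apply, LinearMap.smul_apply, LinearMap.smul_apply, Module.End.one_apply, ← hφCdef, hφv,
      smul_smul, ← add_smul, map_smul, LinearMap.smul_apply, h0, smul_zero]
  -- `𝔊 = 𝔰𝔩(W)` by §1, applied to `Y|_W`
  have hYW : ∀ w ∈ W, Y w ∈ W := fun w hw => UnitaryTheta.apply_mem_eigenspace_of_commute hYφ hw
  have hYtrW : LinearMap.trace ℂ W (Y.restrict hYW) = 0 :=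
    UnitaryThetaTwoTwo.trace_restrict_eq_zero hφ2 hμ hμ0 hYφ (UnitaryThetaTwoTwo.trace_eq_zero_of_skew hN hYskew)
      hYsu hYW
  have hYres : Y.restrict hYW ∈ 𝔊 :=
    UnitaryThetaTwoTwo.mem_of_trace_eq_zero_of_irreducible hbr𝔊 hsl𝔊 hirr𝔊 hΘW𝔊 hΘWΘW hPW hQW hfinP hfinQ
      hND𝔊 hYtrW
  obtain ⟨Z, hZ, hZY⟩ := (hmem𝔊 _).1 hYres
  -- and `Y = Z` by determination on `W`
  have hD := UnitaryTheta.eq_zero_of_forall_mem_eigenspace H ψ hφE hd hφ2 hE hμ (D := Z - Y)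
    (by rw [sub_mul, mul_sub, UnitaryTheta.commute_of_mem_spanC H hφE hcomm hZ, hYφ])
    (fun x y => by
      have h3 := ThetaSubalgebra.formBaseChange_add_eq_zero_of_mem_spanC ψ hskew hZ x y
      have h4 := hYskew x y
      rw [LinearMap.sub_apply, LinearMap.sub_apply, map_sub, LinearMap.sub_apply, map_sub]
      linear_combination h3 - h4)
    (fun w hw => by
      rw [LinearMap.sub_apply, sub_eq_zero, ← hZY ⟨w, hw⟩]
      rfl)
  rw [sub_eq_zero] at hD
  exact hD ▸ hZ

end Hodge

/-! ### §3 The Hodge Lie algebra: `Lie Hg(H) ⊗ ℂ ⊇ 𝔰𝔲_K(V, ψ)_ℂ` for weight one, `End_Hdg = K` acting with multiplicities `(2,2)` («`Hg ⊇ SU(V, ψ)`») -/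

section HodgeLie

universe u

variable {V : Type u} [AddCommGroup V] [Module ℚ V] [Module.Finite ℚ V] [HodgeTensorFacts.{u, u}] {n : ℤ}

omit [Module.Finite ℚ V] [HodgeTensorFacts.{u, u}] in
/-- `(𝔞 + 𝔟)_ℂ ⊆ 𝔞_ℂ + 𝔟_ℂ` (the tree's `spanC_sup` of `Motives/HodgeLieWeightOneSl2Center`, one inclusion, restated to keep the
imports of this file small). [folklore] -/
private theorem UnitaryThetaTwoTwo.spanC_sup_le (𝔞 𝔟 : Submodule ℚ (Module.End ℚ V)) :
    spanC (𝔞 ⊔ 𝔟) ≤ spanC 𝔞 ⊔ spanC 𝔟 := by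
  unfold spanC
  rw [Submodule.span_le]
  rintro _ ⟨Z, hZ, rfl⟩
  obtain ⟨a, ha, b, hb, rfl⟩ := Submodule.mem_sup.1 hZ
  change (a + b).baseChange ℂ ∈ _
  rw [LinearMap.baseChange_add]
  exact Submodule.add_mem_sup (Submodule.subset_span ⟨a, ha, rfl⟩) (Submodule.subset_span ⟨b, hb, rfl⟩)

/-- **`Lie Hg(H) ⊗ ℂ ⊇ 𝔰𝔲_K(V, ψ)_ℂ` — «`Hg ⊇ SU(V, ψ)`» for a polarized weight-one Hodge structure with
`End_Hdg(V) = K` imaginary quadratic acting with multiplicities `(2,2)`.** In the setting of §2 with `𝔤 = Lie Hg(H)`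
no `K`-trace hypothesis is needed: every `Y ∈ End(V_ℂ)` commuting with `φ_ℂ`, `ψ_ℂ`-skew and with `tr(φ_ℂ Y) = 0` lies
in `Lie Hg(H) ⊗ ℂ` (the tree's `hodgeLieC`), i.e. kills every Hodge tensor of `H`. Proof: apply §2 to the DERIVED algebra
`𝔡 = [𝔥, 𝔥]`, `𝔥 = Lie Hg(H)`: it is bracket-closed, commutes with `End_Hdg`, is `ψ`-skew and `K`-traceless
(`Tr(φ[X,X']) = 0` as `φ` commutes with `𝔥`), and `Θ ∈ 𝔡_ℂ`: by `𝔥 = (𝔥 ∩ End_Hdg) ⊕ 𝔡` (Deligne, any weight — the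
tree's `AnyWeight.hodgeLie_center_sup_derived_eq`) `Θ = α + βφ_ℂ + δ` with `δ ∈ 𝔡_ℂ`; `tr Θ = tr δ = tr φ_ℂ = 0`
(`ψ_ℂ`-skew operators are traceless) gives `α = 0`, and on `W` the traces of `Θ|_W` (eigenvalues `±1` with multiplicity
`2`) and of `δ|_W` vanish, so `4βμ = 0`. (Equality `Lie Hg = 𝔰𝔲_K(V,ψ)`, i.e. `φ ∉ Lie Hg`, is the statement that the Weil
classes `⋀⁴_K V` are Hodge classes for `n' = n''`; it is not needed for «Hodge classes are `SU(V,ψ)`-invariants».)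
Moonen–Zarhin: for a simple abelian fourfold of type IV(1,1) with `End⁰ = K` of signature `(2,2)`, `Hg = SU(V,ψ)` and
the Hodge ring is generated by divisor classes and Weil classes. [cite: MoonenZarhin1999LowDim, §2 (2.5) (2)]
[cite: MoonenZarhin1995Duke, main theorem (type IV(1,1), (2,2))] [cite: vanGeemen1994HodgeAV, Lemma 6.10 and Thm. 6.11]
[cite: Deligne1982HodgeCycles, I §3 Prop. 3.6] -/
theorem UnitaryThetaTwoTwo.mem_hodgeLieC_of_commute_of_skew (H : HodgeStructure V n) (hn : n = 1)
    (heff : H.IsEffective) (ψ : H.Polarization) {φ : Module.End ℚ V} (hφE : φ ∈ H.endAlg) {d : ℚ} (hd : 0 < d)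
    (hφ2 : φ * φ = -(d • 1)) (hE : ∀ a ∈ H.endAlg, ∃ x y : ℚ, a = x • 1 + y • φ) {μ : ℂ} (hμ : μ ^ 2 = -(d : ℂ))
    (h22 : Module.finrank ℂ ↥(Module.End.eigenspace (φ.baseChange ℂ) μ ⊓ H.piece 1 0) = 2 ∧
        Module.finrank ℂ ↥(Module.End.eigenspace (φ.baseChange ℂ) μ ⊓ H.piece 0 1) = 2)
    {Y : Module.End ℂ (ℂ ⊗[ℚ] V)} (hYφ : Y * φ.baseChange ℂ = φ.baseChange ℂ * Y)
    (hYskew : ∀ x y, ψ.form.baseChange ℂ (Y x) y + ψ.form.baseChange ℂ x (Y y) = 0)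
    (hYsu : LinearMap.trace ℂ (ℂ ⊗[ℚ] V) (φ.baseChange ℂ * Y) = 0) : Y ∈ H.hodgeLieC := by
  classical
  obtain ⟨hbr, hskew, hcomm, Θ, hΘ, hΘ𝔥⟩ := hodgeLie_standing H ψ
  obtain ⟨hPhat, hQhat, hΘ10, hΘ01, hΘΘ⟩ := UnitaryTheta.theta_facts H hn heff hΘ
  obtain ⟨hμ0, -⟩ := UnitaryTheta.conj_eq_neg_of_sq hd hμ
  set φC := φ.baseChange ℂ with hφCdef
  set ψC := ψ.form.baseChange ℂ with hψCdef
  set W := Module.End.eigenspace φC μ with hWdef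
  have hN : ψC.Nondegenerate :=
    ⟨fun _ hx => ψ.eq_zero_of_forall_form_eq_zero hx, fun _ hy => ψ.eq_zero_of_forall_form_eq_zero' hy⟩
  have hΘC : Θ ∈ H.hodgeLieC := H.mem_hodgeLieC_of_forall_piece hΘ
  -- the derived algebra `𝔡 = [𝔥, 𝔥]`
  set 𝔡 : Submodule ℚ (Module.End ℚ V) :=
    Submodule.span ℚ {B | ∃ X ∈ H.hodgeLie, ∃ Y ∈ H.hodgeLie, X * Y - Y * X = B} with h𝔡def
  have h𝔡le : 𝔡 ≤ H.hodgeLie := Submodule.span_le.2 (by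
    rintro _ ⟨X, hX, X', hX', rfl⟩
    exact hbr X hX X' hX')
  have hbr𝔡 : ∀ X ∈ 𝔡, ∀ X' ∈ 𝔡, X * X' - X' * X ∈ 𝔡 := fun X hX X' hX' =>
    Submodule.subset_span ⟨X, h𝔡le hX, X', h𝔡le hX', rfl⟩
  have hcomm𝔡 : ∀ X ∈ 𝔡, ∀ a : H.endAlg, X * (a : Module.End ℚ V) = (a : Module.End ℚ V) * X :=
    fun X hX a => hcomm X (h𝔡le hX) a
  have hskew𝔡 : ∀ X ∈ 𝔡, ∀ v w, ψ.form (X v) w + ψ.form v (X w) = 0 := fun X hX => hskew X (h𝔡le hX)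
  -- `𝔡` is `K`-traceless: `Tr(φ (X X' − X' X)) = 0` since `φ` commutes with `𝔥`
  have hφcomm : ∀ X ∈ H.hodgeLie, X * φ = φ * X := fun X hX => hcomm X hX ⟨φ, hφE⟩
  have hsu𝔡 : ∀ X ∈ 𝔡, LinearMap.trace ℚ V (φ * X) = 0 := by
    intro X hX
    induction hX using Submodule.span_induction with
    | mem B hB =>
      obtain ⟨X, hX, X', hX', rfl⟩ := hB
      rw [mul_sub, map_sub, sub_eq_zero, ← mul_assoc φ X' X, LinearMap.trace_mul_comm ℚ (φ * X') X,
        ← mul_assoc X φ X', hφcomm X hX, mul_assoc]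
    | zero => rw [mul_zero, map_zero]
    | add _ _ _ _ h1 h2 => rw [mul_add, map_add, h1, h2, add_zero]
    | smul c _ _ h => rw [mul_smul_comm, map_smul, h, smul_zero]
  -- `Θ = ζ + δ`, `ζ ∈ (𝔥 ∩ End_Hdg)_ℂ = ℂ + ℂφ_ℂ`, `δ ∈ 𝔡_ℂ`
  have hΘsum : Θ ∈ spanC (H.hodgeLie ⊓ Subalgebra.toSubmodule H.endAlg) ⊔ spanC 𝔡 := by
    refine UnitaryThetaTwoTwo.spanC_sup_le _ _ ?_
    rw [h𝔡def, AnyWeight.hodgeLie_center_sup_derived_eq H ψ]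
    exact hΘ𝔥
  obtain ⟨ζ, hζ, δ, hδ, hζδ⟩ := Submodule.mem_sup.1 hΘsum
  have hζE : ζ ∈ Submodule.span ℂ ((fun a : Module.End ℚ V => a.baseChange ℂ) '' (H.endAlg : Set _)) := by
    have hsub : (fun a : Module.End ℚ V => a.baseChange ℂ) ''
          ((H.hodgeLie ⊓ Subalgebra.toSubmodule H.endAlg : Submodule ℚ (Module.End ℚ V)) :
            Set (Module.End ℚ V)) ⊆
        (fun a : Module.End ℚ V => a.baseChange ℂ) '' (H.endAlg : Set _) := by
      rintro _ ⟨X, hX, rfl⟩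
      exact ⟨X, (Subalgebra.mem_toSubmodule _).1 (Submodule.mem_inf.1 hX).2, rfl⟩
    exact Submodule.span_mono hsub hζ
  obtain ⟨α, β, hζeq⟩ := UnitaryTheta.exists_eq_of_mem_span_endAlg H hE hζE
  have hδ𝔥 : δ ∈ H.hodgeLieC := by
    rw [hodgeLieC_eq_spanC]
    exact Submodule.span_mono (Set.image_mono fun X hX => h𝔡le hX) hδ
  have hδφ : δ * φC = φC * δ := UnitaryTheta.commute_of_mem_spanC H hφE hcomm𝔡 hδ
  have hδskew : ∀ x y, ψC (δ x) y + ψC x (δ y) = 0 := fun x y => by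
    rw [hψCdef, formBaseChange_skew_of_mem_hodgeLieC ψ hδ𝔥, neg_add_cancel]
  have hΘskew : ∀ x y, ψC (Θ x) y + ψC x (Θ y) = 0 := fun x y => by
    rw [hψCdef, formBaseChange_skew_of_mem_hodgeLieC ψ hΘC, neg_add_cancel]
  -- a non-zero vector of `W`, hence `V` is nontrivial
  have hWpos : 0 < Module.finrank ℂ ↥(W ⊓ H.piece 1 0) := by rw [h22.1]; exact two_pos
  haveI : Nontrivial ↥(W ⊓ H.piece 1 0) := Module.nontrivial_of_finrank_pos (R := ℂ) hWpos
  obtain ⟨⟨x₀, hx₀⟩, hx₀0⟩ := exists_ne (0 : ↥(W ⊓ H.piece 1 0))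
  have hx₀0' : x₀ ≠ 0 := fun h => hx₀0 (Subtype.ext h)
  haveI : Nontrivial V := by
    by_contra hV
    have hsub : Subsingleton V := not_nontrivial_iff_subsingleton.1 hV
    have hzero : ∀ x : ℂ ⊗[ℚ] V, x = 0 := fun x => by
      induction x using TensorProduct.induction_on with
      | zero => rfl
      | tmul c v => rw [Subsingleton.elim v 0, TensorProduct.tmul_zero]
      | add x y hx hy => rw [hx, hy, add_zero]
    exact hx₀0' (hzero x₀)
  have hφskew : ∀ x y, ψC (φC x) y + ψC x (φC y) = 0 :=
    ThetaSubalgebra.formBaseChange_add_eq_zero_of_skew ψ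
      (UnitaryTheta.form_apply_add_form_apply_eq_zero H ψ hφE hd hφ2 hE)
  -- `α = 0`: traces on `V_ℂ`
  have htrΘ : LinearMap.trace ℂ _ Θ = 0 := UnitaryThetaTwoTwo.trace_eq_zero_of_skew hN hΘskew
  have htrδ : LinearMap.trace ℂ _ δ = 0 := UnitaryThetaTwoTwo.trace_eq_zero_of_skew hN hδskew
  have htrφ : LinearMap.trace ℂ _ φC = 0 := UnitaryThetaTwoTwo.trace_eq_zero_of_skew hN hφskew
  have hα : α = 0 := by
    have h := congrArg (LinearMap.trace ℂ (ℂ ⊗[ℚ] V)) hζδ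
    rw [map_add, hζeq, map_add, map_smul, map_smul, LinearMap.trace_one, ← hφCdef, htrφ, htrδ, htrΘ, smul_zero,
      add_zero, add_zero, smul_eq_mul, Module.finrank_baseChange] at h
    have hV : (Module.finrank ℚ V : ℂ) ≠ 0 := by exact_mod_cast Module.finrank_pos.ne'
    exact (mul_eq_zero.1 h).resolve_right hV
  rw [hα, zero_smul, zero_add] at hζeq
  -- `β = 0`: traces on `W`
  have hΘW : ∀ w ∈ W, Θ w ∈ W := fun w hw =>
    UnitaryTheta.apply_mem_eigenspace_of_commute (UnitaryTheta.commute_of_mem_spanC H hφE hcomm hΘ𝔥) hw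
  have hδW : ∀ w ∈ W, δ w ∈ W := fun w hw => UnitaryTheta.apply_mem_eigenspace_of_commute hδφ hw
  have htrδW : LinearMap.trace ℂ W (δ.restrict hδW) = 0 :=
    UnitaryThetaTwoTwo.trace_restrict_eq_zero hφ2 hμ hμ0 hδφ htrδ
      (UnitaryThetaTwoTwo.trace_baseChange_mul_eq_zero_of_mem_spanC 𝔡 hsu𝔡 hδ) hδW
  -- `tr(Θ|_W) = 0`: eigenvalues `±1` with multiplicities `2, 2`
  set ΘW : Module.End ℂ W := Θ.restrict hΘW with hΘWdef
  have hΘWapply : ∀ w : W, (ΘW w : ℂ ⊗[ℚ] V) = Θ w := fun w => rfl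
  set PW : Submodule ℂ W := LinearMap.ker (ΘW - 1) with hPWdef
  set QW : Submodule ℂ W := LinearMap.ker (ΘW + 1) with hQWdef
  have hPW : ∀ x, x ∈ PW ↔ ΘW x = x := fun x => by
    rw [hPWdef, LinearMap.mem_ker, LinearMap.sub_apply, Module.End.one_apply, sub_eq_zero]
  have hQW : ∀ x, x ∈ QW ↔ ΘW x = -x := fun x => by
    rw [hQWdef, LinearMap.mem_ker, LinearMap.add_apply, Module.End.one_apply, add_eq_zero_iff_eq_neg]
  have hPWeq : PW = Submodule.comap W.subtype (W ⊓ H.piece 1 0) := by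
    ext x
    rw [hPW, Submodule.mem_comap, Submodule.subtype_apply, Submodule.mem_inf]
    constructor
    · intro h
      have hx : Θ x = x := by rw [← hΘWapply, h]
      refine ⟨x.2, ?_⟩
      have hx' : (x : ℂ ⊗[ℚ] V) = (2 : ℂ)⁻¹ • ((x : ℂ ⊗[ℚ] V) + Θ x) := by rw [hx]; module
      rw [hx']
      exact hPhat _
    · rintro ⟨-, hx10⟩
      apply Subtype.ext
      rw [hΘWapply]
      exact hΘ10 _ hx10
  have hQWeq : QW = Submodule.comap W.subtype (W ⊓ H.piece 0 1) := by
    ext x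
    rw [hQW, Submodule.mem_comap, Submodule.subtype_apply, Submodule.mem_inf]
    constructor
    · intro h
      have hx : Θ x = -x := by rw [← hΘWapply, h, Submodule.coe_neg]
      refine ⟨x.2, ?_⟩
      have hx' : (x : ℂ ⊗[ℚ] V) = (2 : ℂ)⁻¹ • ((x : ℂ ⊗[ℚ] V) - Θ x) := by rw [hx]; module
      rw [hx']
      exact hQhat _
    · rintro ⟨-, hx01⟩
      apply Subtype.ext
      rw [hΘWapply, Submodule.coe_neg]
      exact hΘ01 _ hx01
  have hfinP : Module.finrank ℂ PW = 2 := by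
    rw [hPWeq, ← h22.1]; exact (Submodule.comapSubtypeEquivOfLe inf_le_left).finrank_eq
  have hfinQ : Module.finrank ℂ QW = 2 := by
    rw [hQWeq, ← h22.2]; exact (Submodule.comapSubtypeEquivOfLe inf_le_left).finrank_eq
  have hcPQ : IsCompl PW QW := by
    refine ⟨disjoint_iff.2 (eq_bot_iff.2 fun x hx => ?_), codisjoint_iff.2 (eq_top_iff.2 fun w _ => ?_)⟩
    · obtain ⟨hP, hQ⟩ := Submodule.mem_inf.1 hx
      rw [Submodule.mem_bot]
      have h1 := (hPW x).1 hP
      rw [(hQW x).1 hQ] at h1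
      have h2 : (2 : ℂ) • x = 0 := by rw [two_smul]; nth_rewrite 1 [← h1]; rw [neg_add_cancel]
      exact (smul_eq_zero.1 h2).resolve_left (two_ne_zero' ℂ)
    · have hw : w = (2 : ℂ)⁻¹ • (w + ΘW w) + (2 : ℂ)⁻¹ • (w - ΘW w) := by module
      have hΘΘW : ∀ v : W, ΘW (ΘW v) = v := fun v => Subtype.ext (by rw [hΘWapply, hΘWapply, hΘΘ])
      rw [hw]
      refine Submodule.add_mem_sup ((hPW _).2 ?_) ((hQW _).2 ?_)
      · rw [map_smul, map_add, hΘΘW, add_comm]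
      · rw [map_smul, map_sub, hΘΘW]
        module
  let N' : Bool → Submodule ℂ W := fun b => cond b PW QW
  have hint : DirectSum.IsInternal N' :=
    (DirectSum.isInternal_submodule_iff_isCompl N' (i := true) (j := false) (by decide)
      (Set.eq_univ_of_forall fun b => by cases b <;> simp).symm).2 hcPQ
  have hΘPW : ∀ x ∈ PW, ΘW x ∈ PW := fun x hx => by
    rw [hPW] at hx ⊢
    rw [hx]
    exact hx
  have hΘQW : ∀ x ∈ QW, ΘW x ∈ QW := fun x hx => by
    rw [hQW] at hx ⊢
    rw [hx, map_neg, hx]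
  have hmaps : ∀ b, Set.MapsTo ΘW (N' b) (N' b) := fun b =>
    match b with
    | true => hΘPW
    | false => hΘQW
  have hsplit := LinearMap.trace_eq_sum_trace_restrict hint hmaps
  rw [Fintype.sum_bool] at hsplit
  have hsplit' : LinearMap.trace ℂ W ΘW =
      LinearMap.trace ℂ PW (ΘW.restrict hΘPW) + LinearMap.trace ℂ QW (ΘW.restrict hΘQW) := hsplit
  have hrP : ΘW.restrict hΘPW = LinearMap.id := by
    refine LinearMap.ext fun x => Subtype.ext ?_
    rw [LinearMap.coe_restrict_apply, LinearMap.id_apply]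
    exact (hPW x.1).1 x.2
  have hrQ : ΘW.restrict hΘQW = (-1 : ℂ) • LinearMap.id := by
    refine LinearMap.ext fun x => Subtype.ext ?_
    rw [LinearMap.coe_restrict_apply, LinearMap.smul_apply, LinearMap.id_apply, neg_one_smul ℂ x,
      Submodule.coe_neg]
    exact (hQW x.1).1 x.2
  haveI : Module.Free ℂ PW := Module.Free.of_divisionRing ℂ PW
  haveI : Module.Free ℂ QW := Module.Free.of_divisionRing ℂ QW
  have e1 : LinearMap.trace ℂ PW LinearMap.id = (Module.finrank ℂ PW : ℂ) := LinearMap.trace_id ℂ PW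
  have e2 : LinearMap.trace ℂ QW LinearMap.id = (Module.finrank ℂ QW : ℂ) := LinearMap.trace_id ℂ QW
  rw [hrP, hrQ, map_smul, e1, e2, hfinP, hfinQ, smul_eq_mul] at hsplit'
  have htrΘW : LinearMap.trace ℂ W ΘW = 0 := by rw [hsplit']; norm_num
  -- `Θ|_W = βμ + δ|_W`
  have hΘWeq : ΘW = (β * μ) • LinearMap.id + δ.restrict hδW := LinearMap.ext fun w => Subtype.ext (by
    rw [hΘWapply, LinearMap.add_apply, Submodule.coe_add, LinearMap.smul_apply, Submodule.coe_smul,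
      LinearMap.id_apply, LinearMap.coe_restrict_apply, hζδ.symm, LinearMap.add_apply, hζeq, LinearMap.smul_apply,
      ← hφCdef, Module.End.mem_eigenspace_iff.1 w.2, smul_smul])
  have hβ : β = 0 := by
    have h := htrΘW
    have e3 : LinearMap.trace ℂ W LinearMap.id = (Module.finrank ℂ W : ℂ) := LinearMap.trace_id ℂ W
    rw [hΘWeq, map_add, map_smul, e3, htrδW, add_zero, smul_eq_mul] at h
    have hWfin : (Module.finrank ℂ W : ℂ) ≠ 0 := by
      have h1 : Module.finrank ℂ PW ≤ Module.finrank ℂ W := Submodule.finrank_le PW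
      have h2 : 0 < Module.finrank ℂ W := by omega
      exact_mod_cast h2.ne'
    rcases mul_eq_zero.1 h with h3 | h3
    · exact (mul_eq_zero.1 h3).resolve_right hμ0
    · exact absurd h3 hWfin
  -- hence `Θ = δ ∈ 𝔡_ℂ`, and §2 applies to `𝔡`
  have hΘ𝔡 : Θ ∈ spanC 𝔡 := by
    have hΘδ : Θ = δ := by rw [← hζδ, hζeq, hβ, zero_smul, zero_add]
    rw [hΘδ]; exact hδ
  have hY : Y ∈ spanC 𝔡 :=
    UnitaryThetaTwoTwo.mem_spanC_of_commute_of_skew H hn heff ψ hφE hd hφ2 hE hμ h22 𝔡 hbr𝔡 hΘ hΘ𝔡 hcomm𝔡 hskew𝔡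
      hsu𝔡 hYφ hYskew hYsu
  rw [hodgeLieC_eq_spanC]
  exact Submodule.span_mono (Set.image_mono fun X hX => h𝔡le hX) hY

end HodgeLie

/-! ### §4 Any `Θ`-subalgebra: `𝔤_ℂ ⊇ 𝔰𝔲_K(V, ψ)_ℂ` without the `K`-trace hypothesis, and THEOREM L for `𝔰𝔲` on rational tensors -/

section General

open Literature.RepresentationTheory.GeneralLinear Literature.NumberTheory.DiophantineGeometry

universe u

variable {V : Type u} [AddCommGroup V] [Module ℚ V] [Module.Finite ℚ V] [HodgeTensorFacts.{u, u}] {n : ℤ}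

/-- **`𝔤_ℂ ⊇ 𝔰𝔲_K(V, ψ)_ℂ` for multiplicities `(2,2)` WITHOUT the `K`-trace hypothesis of §2.** For ANY bracket-closed
`ℚ`-subspace `𝔤` of operators commuting with `End_Hdg(V) = ℚ + ℚφ` and `ψ`-skew whose complex span contains `Θ`
(setting of §2: weight one, effective, `φ² = -d`, `dim W^{1,0} = dim W^{0,1} = 2`), every `Y` commuting with `φ_ℂ`,
`ψ_ℂ`-skew, with `tr(φ_ℂ Y) = 0` lies in `𝔤_ℂ`. Proof (the argument of §3 for a general `Θ`-subalgebra): by Deligne's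
reductivity in the Lie form for `Θ`-subalgebras — `𝔤 = (𝔤 ∩ End_Hdg) ⊕ [𝔤, 𝔤]` (the tree's
`ThetaSubalgebra.center_sup_derived_eq` with `center_eq_inf_endAlg`, effective weight one) — `Θ = α + βφ_ℂ + δ` with
`δ ∈ [𝔤,𝔤]_ℂ`; the derived algebra is `K`-traceless (`Tr(φ[X,X']) = 0`), `α = 0` by traces on `V_ℂ` and `β = 0` by traces
on `W` (`tr Θ|_W = 2 − 2`), so `Θ ∈ [𝔤,𝔤]_ℂ` and §2 applies to `[𝔤, 𝔤] ⊆ 𝔰𝔲_K(V,ψ)`. (§3 is the case `𝔤 = Lie Hg(H)`.)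
[cite: MoonenZarhin1999LowDim, §2 (2.5) (2)] [cite: MoonenZarhin1995Duke, main theorem (type IV(1,1), (2,2))]
[cite: Deligne1982HodgeCycles, I §3 Prop. 3.6] [cite: vanGeemen1994HodgeAV, Lemma 6.10 and Thm. 6.11] -/
theorem UnitaryThetaTwoTwo.mem_spanC_of_commute_of_skew' (H : HodgeStructure V n) (hn : n = 1)
    (heff : H.IsEffective) (ψ : H.Polarization) {φ : Module.End ℚ V} (hφE : φ ∈ H.endAlg) {d : ℚ} (hd : 0 < d)
    (hφ2 : φ * φ = -(d • 1)) (hE : ∀ a ∈ H.endAlg, ∃ x y : ℚ, a = x • 1 + y • φ) {μ : ℂ} (hμ : μ ^ 2 = -(d : ℂ))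
    (h22 : Module.finrank ℂ ↥(Module.End.eigenspace (φ.baseChange ℂ) μ ⊓ H.piece 1 0) = 2 ∧
        Module.finrank ℂ ↥(Module.End.eigenspace (φ.baseChange ℂ) μ ⊓ H.piece 0 1) = 2)
    (𝔤 : Submodule ℚ (Module.End ℚ V)) (hbr : ∀ X ∈ 𝔤, ∀ X' ∈ 𝔤, X * X' - X' * X ∈ 𝔤)
    {Θ : Module.End ℂ (ℂ ⊗[ℚ] V)} (hΘ : ∀ p, ∀ x ∈ H.piece p (n - p), Θ x = ((2 * p - n : ℤ) : ℂ) • x)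
    (hΘ𝔤 : Θ ∈ spanC 𝔤)
    (hcomm : ∀ X ∈ 𝔤, ∀ a : H.endAlg, X * (a : Module.End ℚ V) = (a : Module.End ℚ V) * X)
    (hskew : ∀ X ∈ 𝔤, ∀ v w, ψ.form (X v) w + ψ.form v (X w) = 0)
    {Y : Module.End ℂ (ℂ ⊗[ℚ] V)} (hYφ : Y * φ.baseChange ℂ = φ.baseChange ℂ * Y)
    (hYskew : ∀ x y, ψ.form.baseChange ℂ (Y x) y + ψ.form.baseChange ℂ x (Y y) = 0)
    (hYsu : LinearMap.trace ℂ (ℂ ⊗[ℚ] V) (φ.baseChange ℂ * Y) = 0) : Y ∈ spanC 𝔤 := by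
  classical
  obtain ⟨hPhat, hQhat, hΘ10, hΘ01, hΘΘ⟩ := UnitaryTheta.theta_facts H hn heff hΘ
  obtain ⟨hμ0, -⟩ := UnitaryTheta.conj_eq_neg_of_sq hd hμ
  set φC := φ.baseChange ℂ with hφCdef
  set ψC := ψ.form.baseChange ℂ with hψCdef
  set W := Module.End.eigenspace φC μ with hWdef
  have hN : ψC.Nondegenerate :=
    ⟨fun _ hx => ψ.eq_zero_of_forall_form_eq_zero hx, fun _ hy => ψ.eq_zero_of_forall_form_eq_zero' hy⟩
  -- the derived algebra `𝔡 = [𝔤, 𝔤]`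
  set 𝔡 : Submodule ℚ (Module.End ℚ V) :=
    Submodule.span ℚ {B | ∃ X ∈ 𝔤, ∃ Y ∈ 𝔤, X * Y - Y * X = B} with h𝔡def
  have h𝔡le : 𝔡 ≤ 𝔤 := Submodule.span_le.2 (by
    rintro _ ⟨X, hX, X', hX', rfl⟩
    exact hbr X hX X' hX')
  have hbr𝔡 : ∀ X ∈ 𝔡, ∀ X' ∈ 𝔡, X * X' - X' * X ∈ 𝔡 := fun X hX X' hX' =>
    Submodule.subset_span ⟨X, h𝔡le hX, X', h𝔡le hX', rfl⟩
  have hcomm𝔡 : ∀ X ∈ 𝔡, ∀ a : H.endAlg, X * (a : Module.End ℚ V) = (a : Module.End ℚ V) * X :=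
    fun X hX a => hcomm X (h𝔡le hX) a
  have hskew𝔡 : ∀ X ∈ 𝔡, ∀ v w, ψ.form (X v) w + ψ.form v (X w) = 0 := fun X hX => hskew X (h𝔡le hX)
  -- `𝔡` is `K`-traceless: `Tr(φ (X X' − X' X)) = 0` since `φ` commutes with `𝔤`
  have hφcomm : ∀ X ∈ 𝔤, X * φ = φ * X := fun X hX => hcomm X hX ⟨φ, hφE⟩
  have hsu𝔡 : ∀ X ∈ 𝔡, LinearMap.trace ℚ V (φ * X) = 0 := by
    intro X hX
    induction hX using Submodule.span_induction with
    | mem B hB =>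
      obtain ⟨X, hX, X', hX', rfl⟩ := hB
      rw [mul_sub, map_sub, sub_eq_zero, ← mul_assoc φ X' X, LinearMap.trace_mul_comm ℚ (φ * X') X,
        ← mul_assoc X φ X', hφcomm X hX, mul_assoc]
    | zero => rw [mul_zero, map_zero]
    | add _ _ _ _ h1 h2 => rw [mul_add, map_add, h1, h2, add_zero]
    | smul c _ _ h => rw [mul_smul_comm, map_smul, h, smul_zero]
  -- `Θ = ζ + δ`, `ζ ∈ (𝔤 ∩ End_Hdg)_ℂ = ℂ + ℂφ_ℂ`, `δ ∈ 𝔡_ℂ` (Deligne: `𝔤 = 𝔷(𝔤) ⊕ [𝔤, 𝔤]`)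
  have hΘsum : Θ ∈ spanC (𝔤 ⊓ Subalgebra.toSubmodule H.endAlg) ⊔ spanC 𝔡 := by
    refine UnitaryThetaTwoTwo.spanC_sup_le _ _ ?_
    rw [← center_eq_inf_endAlg H 𝔤 hΘ hΘ𝔤 hcomm, h𝔡def,
      ThetaSubalgebra.center_sup_derived_eq H hn heff ψ 𝔤 hbr hΘ hΘ𝔤 hskew]
    exact hΘ𝔤
  obtain ⟨ζ, hζ, δ, hδ, hζδ⟩ := Submodule.mem_sup.1 hΘsum
  have hζE : ζ ∈ Submodule.span ℂ ((fun a : Module.End ℚ V => a.baseChange ℂ) '' (H.endAlg : Set _)) := by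
    have hsub : (fun a : Module.End ℚ V => a.baseChange ℂ) ''
          ((𝔤 ⊓ Subalgebra.toSubmodule H.endAlg : Submodule ℚ (Module.End ℚ V)) :
            Set (Module.End ℚ V)) ⊆
        (fun a : Module.End ℚ V => a.baseChange ℂ) '' (H.endAlg : Set _) := by
      rintro _ ⟨X, hX, rfl⟩
      exact ⟨X, (Subalgebra.mem_toSubmodule _).1 (Submodule.mem_inf.1 hX).2, rfl⟩
    exact Submodule.span_mono hsub hζ
  obtain ⟨α, β, hζeq⟩ := UnitaryTheta.exists_eq_of_mem_span_endAlg H hE hζE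
  have hδ𝔤 : δ ∈ spanC 𝔤 := Submodule.span_mono (Set.image_mono fun X hX => h𝔡le hX) hδ
  have hδφ : δ * φC = φC * δ := UnitaryTheta.commute_of_mem_spanC H hφE hcomm𝔡 hδ
  have hδskew : ∀ x y, ψC (δ x) y + ψC x (δ y) = 0 :=
    ThetaSubalgebra.formBaseChange_add_eq_zero_of_mem_spanC ψ hskew hδ𝔤
  have hΘskew : ∀ x y, ψC (Θ x) y + ψC x (Θ y) = 0 :=
    ThetaSubalgebra.formBaseChange_add_eq_zero_of_mem_spanC ψ hskew hΘ𝔤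
  -- a non-zero vector of `W`, hence `V` is nontrivial
  have hWpos : 0 < Module.finrank ℂ ↥(W ⊓ H.piece 1 0) := by rw [h22.1]; exact two_pos
  haveI : Nontrivial ↥(W ⊓ H.piece 1 0) := Module.nontrivial_of_finrank_pos (R := ℂ) hWpos
  obtain ⟨⟨x₀, hx₀⟩, hx₀0⟩ := exists_ne (0 : ↥(W ⊓ H.piece 1 0))
  have hx₀0' : x₀ ≠ 0 := fun h => hx₀0 (Subtype.ext h)
  haveI : Nontrivial V := by
    by_contra hV
    have hsub : Subsingleton V := not_nontrivial_iff_subsingleton.1 hV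
    have hzero : ∀ x : ℂ ⊗[ℚ] V, x = 0 := fun x => by
      induction x using TensorProduct.induction_on with
      | zero => rfl
      | tmul c v => rw [Subsingleton.elim v 0, TensorProduct.tmul_zero]
      | add x y hx hy => rw [hx, hy, add_zero]
    exact hx₀0' (hzero x₀)
  have hφskew : ∀ x y, ψC (φC x) y + ψC x (φC y) = 0 :=
    ThetaSubalgebra.formBaseChange_add_eq_zero_of_skew ψ
      (UnitaryTheta.form_apply_add_form_apply_eq_zero H ψ hφE hd hφ2 hE)
  -- `α = 0`: traces on `V_ℂ`
  have htrΘ : LinearMap.trace ℂ _ Θ = 0 := UnitaryThetaTwoTwo.trace_eq_zero_of_skew hN hΘskew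
  have htrδ : LinearMap.trace ℂ _ δ = 0 := UnitaryThetaTwoTwo.trace_eq_zero_of_skew hN hδskew
  have htrφ : LinearMap.trace ℂ _ φC = 0 := UnitaryThetaTwoTwo.trace_eq_zero_of_skew hN hφskew
  have hα : α = 0 := by
    have h := congrArg (LinearMap.trace ℂ (ℂ ⊗[ℚ] V)) hζδ
    rw [map_add, hζeq, map_add, map_smul, map_smul, LinearMap.trace_one, ← hφCdef, htrφ, htrδ, htrΘ, smul_zero,
      add_zero, add_zero, smul_eq_mul, Module.finrank_baseChange] at h
    have hV : (Module.finrank ℚ V : ℂ) ≠ 0 := by exact_mod_cast Module.finrank_pos.ne'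
    exact (mul_eq_zero.1 h).resolve_right hV
  rw [hα, zero_smul, zero_add] at hζeq
  -- `β = 0`: traces on `W`
  have hΘW : ∀ w ∈ W, Θ w ∈ W := fun w hw =>
    UnitaryTheta.apply_mem_eigenspace_of_commute (UnitaryTheta.commute_of_mem_spanC H hφE hcomm hΘ𝔤) hw
  have hδW : ∀ w ∈ W, δ w ∈ W := fun w hw => UnitaryTheta.apply_mem_eigenspace_of_commute hδφ hw
  have htrδW : LinearMap.trace ℂ W (δ.restrict hδW) = 0 :=
    UnitaryThetaTwoTwo.trace_restrict_eq_zero hφ2 hμ hμ0 hδφ htrδ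
      (UnitaryThetaTwoTwo.trace_baseChange_mul_eq_zero_of_mem_spanC 𝔡 hsu𝔡 hδ) hδW
  -- `tr(Θ|_W) = 0`: eigenvalues `±1` with multiplicities `2, 2`
  set ΘW : Module.End ℂ W := Θ.restrict hΘW with hΘWdef
  have hΘWapply : ∀ w : W, (ΘW w : ℂ ⊗[ℚ] V) = Θ w := fun w => rfl
  set PW : Submodule ℂ W := LinearMap.ker (ΘW - 1) with hPWdef
  set QW : Submodule ℂ W := LinearMap.ker (ΘW + 1) with hQWdef
  have hPW : ∀ x, x ∈ PW ↔ ΘW x = x := fun x => by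
    rw [hPWdef, LinearMap.mem_ker, LinearMap.sub_apply, Module.End.one_apply, sub_eq_zero]
  have hQW : ∀ x, x ∈ QW ↔ ΘW x = -x := fun x => by
    rw [hQWdef, LinearMap.mem_ker, LinearMap.add_apply, Module.End.one_apply, add_eq_zero_iff_eq_neg]
  have hPWeq : PW = Submodule.comap W.subtype (W ⊓ H.piece 1 0) := by
    ext x
    rw [hPW, Submodule.mem_comap, Submodule.subtype_apply, Submodule.mem_inf]
    constructor
    · intro h
      have hx : Θ x = x := by rw [← hΘWapply, h]
      refine ⟨x.2, ?_⟩
      have hx' : (x : ℂ ⊗[ℚ] V) = (2 : ℂ)⁻¹ • ((x : ℂ ⊗[ℚ] V) + Θ x) := by rw [hx]; module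
      rw [hx']
      exact hPhat _
    · rintro ⟨-, hx10⟩
      apply Subtype.ext
      rw [hΘWapply]
      exact hΘ10 _ hx10
  have hQWeq : QW = Submodule.comap W.subtype (W ⊓ H.piece 0 1) := by
    ext x
    rw [hQW, Submodule.mem_comap, Submodule.subtype_apply, Submodule.mem_inf]
    constructor
    · intro h
      have hx : Θ x = -x := by rw [← hΘWapply, h, Submodule.coe_neg]
      refine ⟨x.2, ?_⟩
      have hx' : (x : ℂ ⊗[ℚ] V) = (2 : ℂ)⁻¹ • ((x : ℂ ⊗[ℚ] V) - Θ x) := by rw [hx]; module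
      rw [hx']
      exact hQhat _
    · rintro ⟨-, hx01⟩
      apply Subtype.ext
      rw [hΘWapply, Submodule.coe_neg]
      exact hΘ01 _ hx01
  have hfinP : Module.finrank ℂ PW = 2 := by
    rw [hPWeq, ← h22.1]; exact (Submodule.comapSubtypeEquivOfLe inf_le_left).finrank_eq
  have hfinQ : Module.finrank ℂ QW = 2 := by
    rw [hQWeq, ← h22.2]; exact (Submodule.comapSubtypeEquivOfLe inf_le_left).finrank_eq
  have hcPQ : IsCompl PW QW := by
    refine ⟨disjoint_iff.2 (eq_bot_iff.2 fun x hx => ?_), codisjoint_iff.2 (eq_top_iff.2 fun w _ => ?_)⟩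
    · obtain ⟨hP, hQ⟩ := Submodule.mem_inf.1 hx
      rw [Submodule.mem_bot]
      have h1 := (hPW x).1 hP
      rw [(hQW x).1 hQ] at h1
      have h2 : (2 : ℂ) • x = 0 := by rw [two_smul]; nth_rewrite 1 [← h1]; rw [neg_add_cancel]
      exact (smul_eq_zero.1 h2).resolve_left (two_ne_zero' ℂ)
    · have hw : w = (2 : ℂ)⁻¹ • (w + ΘW w) + (2 : ℂ)⁻¹ • (w - ΘW w) := by module
      have hΘΘW : ∀ v : W, ΘW (ΘW v) = v := fun v => Subtype.ext (by rw [hΘWapply, hΘWapply, hΘΘ])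
      rw [hw]
      refine Submodule.add_mem_sup ((hPW _).2 ?_) ((hQW _).2 ?_)
      · rw [map_smul, map_add, hΘΘW, add_comm]
      · rw [map_smul, map_sub, hΘΘW]
        module
  let N' : Bool → Submodule ℂ W := fun b => cond b PW QW
  have hint : DirectSum.IsInternal N' :=
    (DirectSum.isInternal_submodule_iff_isCompl N' (i := true) (j := false) (by decide)
      (Set.eq_univ_of_forall fun b => by cases b <;> simp).symm).2 hcPQ
  have hΘPW : ∀ x ∈ PW, ΘW x ∈ PW := fun x hx => by
    rw [hPW] at hx ⊢
    rw [hx]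
    exact hx
  have hΘQW : ∀ x ∈ QW, ΘW x ∈ QW := fun x hx => by
    rw [hQW] at hx ⊢
    rw [hx, map_neg, hx]
  have hmaps : ∀ b, Set.MapsTo ΘW (N' b) (N' b) := fun b =>
    match b with
    | true => hΘPW
    | false => hΘQW
  have hsplit := LinearMap.trace_eq_sum_trace_restrict hint hmaps
  rw [Fintype.sum_bool] at hsplit
  have hsplit' : LinearMap.trace ℂ W ΘW =
      LinearMap.trace ℂ PW (ΘW.restrict hΘPW) + LinearMap.trace ℂ QW (ΘW.restrict hΘQW) := hsplit
  have hrP : ΘW.restrict hΘPW = LinearMap.id := by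
    refine LinearMap.ext fun x => Subtype.ext ?_
    rw [LinearMap.coe_restrict_apply, LinearMap.id_apply]
    exact (hPW x.1).1 x.2
  have hrQ : ΘW.restrict hΘQW = (-1 : ℂ) • LinearMap.id := by
    refine LinearMap.ext fun x => Subtype.ext ?_
    rw [LinearMap.coe_restrict_apply, LinearMap.smul_apply, LinearMap.id_apply, neg_one_smul ℂ x,
      Submodule.coe_neg]
    exact (hQW x.1).1 x.2
  haveI : Module.Free ℂ PW := Module.Free.of_divisionRing ℂ PW
  haveI : Module.Free ℂ QW := Module.Free.of_divisionRing ℂ QW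
  have e1 : LinearMap.trace ℂ PW LinearMap.id = (Module.finrank ℂ PW : ℂ) := LinearMap.trace_id ℂ PW
  have e2 : LinearMap.trace ℂ QW LinearMap.id = (Module.finrank ℂ QW : ℂ) := LinearMap.trace_id ℂ QW
  rw [hrP, hrQ, map_smul, e1, e2, hfinP, hfinQ, smul_eq_mul] at hsplit'
  have htrΘW : LinearMap.trace ℂ W ΘW = 0 := by rw [hsplit']; norm_num
  -- `Θ|_W = βμ + δ|_W`
  have hΘWeq : ΘW = (β * μ) • LinearMap.id + δ.restrict hδW := LinearMap.ext fun w => Subtype.ext (by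
    rw [hΘWapply, LinearMap.add_apply, Submodule.coe_add, LinearMap.smul_apply, Submodule.coe_smul,
      LinearMap.id_apply, LinearMap.coe_restrict_apply, hζδ.symm, LinearMap.add_apply, hζeq, LinearMap.smul_apply,
      ← hφCdef, Module.End.mem_eigenspace_iff.1 w.2, smul_smul])
  have hβ : β = 0 := by
    have h := htrΘW
    have e3 : LinearMap.trace ℂ W LinearMap.id = (Module.finrank ℂ W : ℂ) := LinearMap.trace_id ℂ W
    rw [hΘWeq, map_add, map_smul, e3, htrδW, add_zero, smul_eq_mul] at h
    have hWfin : (Module.finrank ℂ W : ℂ) ≠ 0 := by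
      have h1 : Module.finrank ℂ PW ≤ Module.finrank ℂ W := Submodule.finrank_le PW
      have h2 : 0 < Module.finrank ℂ W := by omega
      exact_mod_cast h2.ne'
    rcases mul_eq_zero.1 h with h3 | h3
    · exact (mul_eq_zero.1 h3).resolve_right hμ0
    · exact absurd h3 hWfin
  -- hence `Θ = δ ∈ 𝔡_ℂ`, and §2 applies to `𝔡`
  have hΘ𝔡 : Θ ∈ spanC 𝔡 := by
    have hΘδ : Θ = δ := by rw [← hζδ, hζeq, hβ, zero_smul, zero_add]
    rw [hΘδ]; exact hδ
  have hY : Y ∈ spanC 𝔡 :=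
    UnitaryThetaTwoTwo.mem_spanC_of_commute_of_skew H hn heff ψ hφE hd hφ2 hE hμ h22 𝔡 hbr𝔡 hΘ hΘ𝔡 hcomm𝔡 hskew𝔡
      hsu𝔡 hYφ hYskew hYsu
  exact Submodule.span_mono (Set.image_mono fun X hX => h𝔡le hX) hY


/-- **THEOREM L for `𝔰𝔲` at multiplicities `(2,2)` (invariance of rational tensors under `𝔰𝔲_K(V, ψ)_ℂ`).** In the
setting of §2, a rational coefficient tensor `q` killed — slice by slice, diagonally — by the matrix of the Hodge operator
`Θ` is killed by the matrix of EVERY `ψ_ℂ`-skew operator `Y` of `V_ℂ` commuting with `φ_ℂ` and with `tr(φ_ℂ Y) = 0`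
(the `(2,2)` companion of the tree's `UnitaryTheta.wordDerAt_eq_zero_of_commute_of_skew` (`(m,1)`) and
`UnitaryThetaTwoThree.wordDerAt_eq_zero_of_commute_of_skew` (`(2,3)`), verbatim with the general theorem
`UnitaryThetaTwoTwo.mem_spanC_of_commute_of_skew'` for the rational annihilator Lie algebra `annLie`, which is
bracket-closed, commutes with `E`, is `ψ`-skew and has `Θ` in its complex span, `mem_spanC_annLie`). This is the Lie
step of «the Hodge ring of the powers of a simple abelian fourfold of type IV(1,1) with `End⁰ = K` of signature `(2,2)`
consists of `SU(V,ψ)`-invariants» (Moonen–Zarhin; van Geemen Thm. 6.12 for the invariant theory).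
[cite: MoonenZarhin1999LowDim, §2 (2.5) (2)] [cite: MoonenZarhin1995Duke, main theorem (type IV(1,1), (2,2))]
[cite: Deligne1982HodgeCycles, I §3 (proof of Prop. 3.4)] [cite: vanGeemen1994HodgeAV, Thm. 6.11 and Thm. 6.12] -/
theorem UnitaryThetaTwoTwo.wordDerAt_eq_zero_of_commute_of_skew (H : HodgeStructure V n) (hn : n = 1)
    (heff : H.IsEffective) (ψ : H.Polarization) {φ : Module.End ℚ V} (hφE : φ ∈ H.endAlg) {d : ℚ} (hd : 0 < d)
    (hφ2 : φ * φ = -(d • 1)) (hE : ∀ a ∈ H.endAlg, ∃ x y : ℚ, a = x • 1 + y • φ) {μ : ℂ} (hμ : μ ^ 2 = -(d : ℂ))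
    (h22 : Module.finrank ℂ ↥(Module.End.eigenspace (φ.baseChange ℂ) μ ⊓ H.piece 1 0) = 2 ∧
        Module.finrank ℂ ↥(Module.End.eigenspace (φ.baseChange ℂ) μ ⊓ H.piece 0 1) = 2)
    {M N k : ℕ} (eQ : Module.Basis (Fin M) ℚ V) (q : (Fin N → Fin k × Fin M) → ℚ)
    {Θ : Module.End ℂ (ℂ ⊗[ℚ] V)} (hΘ : ∀ p, ∀ x ∈ H.piece p (n - p), Θ x = ((2 * p - n : ℤ) : ℂ) • x)
    (hΘq : ∀ u : Fin N → Fin k, wordDerAt ℂ (fun _ : Fin N =>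
      LinearMap.toMatrix (Algebra.TensorProduct.basis ℂ eQ) (Algebra.TensorProduct.basis ℂ eQ) Θ)
      (wordSlice (fun w => algebraMap ℚ ℂ (q w)) u) = 0)
    {Y : Module.End ℂ (ℂ ⊗[ℚ] V)} (hYφ : Y * φ.baseChange ℂ = φ.baseChange ℂ * Y)
    (hYskew : ∀ x y, ψ.form.baseChange ℂ (Y x) y + ψ.form.baseChange ℂ x (Y y) = 0)
    (hYsu : LinearMap.trace ℂ (ℂ ⊗[ℚ] V) (φ.baseChange ℂ * Y) = 0) (u : Fin N → Fin k) :
    wordDerAt ℂ (fun _ : Fin N =>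
      LinearMap.toMatrix (Algebra.TensorProduct.basis ℂ eQ) (Algebra.TensorProduct.basis ℂ eQ) Y)
      (wordSlice (fun w => algebraMap ℚ ℂ (q w)) u) = 0 := by
  set 𝔞 : Submodule ℚ (Module.End ℚ V) := annLie ψ.form eQ (fun a : H.endAlg => (a : Module.End ℚ V)) q
    with h𝔞
  have hΘC : Θ ∈ H.hodgeLieC := H.mem_hodgeLieC_of_forall_piece hΘ
  have hΘ𝔞 : Θ ∈ spanC 𝔞 :=
    mem_spanC_annLie ψ.form eQ _ q hΘq (fun a => commute_baseChange_of_mem_hodgeLieC H hΘC a)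
      fun x y => by rw [formBaseChange_skew_of_mem_hodgeLieC ψ hΘC, neg_add_cancel]
  have hbr : ∀ X ∈ 𝔞, ∀ X' ∈ 𝔞, X * X' - X' * X ∈ 𝔞 := fun X hX X' hX' =>
    commutator_mem_annLie ψ.form eQ _ q hX hX'
  have hcomm : ∀ X ∈ 𝔞, ∀ a : H.endAlg, X * (a : Module.End ℚ V) = (a : Module.End ℚ V) * X :=
    fun X hX a => ((mem_annLie_iff ψ.form eQ _ q X).1 hX).2.1 a
  have hskew : ∀ X ∈ 𝔞, ∀ v w, ψ.form (X v) w + ψ.form v (X w) = 0 :=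
    fun X hX => ((mem_annLie_iff ψ.form eQ _ q X).1 hX).2.2
  have hY : Y ∈ spanC 𝔞 :=
    UnitaryThetaTwoTwo.mem_spanC_of_commute_of_skew' H hn heff ψ hφE hd hφ2 hE hμ h22 𝔞 hbr hΘ hΘ𝔞 hcomm hskew
      hYφ hYskew hYsu
  rw [h𝔞] at hY
  exact wordDerAt_eq_zero_of_mem_spanC_annLie ψ.form eQ _ q hY u

end General

end HodgeStructure

end Literature.AlgebraicGeometry.Motives

end
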